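import Literature.AlgebraicGeometry.Shioda1982.KoblitzOgusRelationsTenPrime
import Literature.AlgebraicGeometry.Shioda1982.PicardNumberTwicePrime
import HarnessLib

/-!
# The pair-free Hodge `4`-multisets of level `10p` (`p ≥ 19` prime) in Chinese-remainder coordinates

Topic `Literature/AlgebraicGeometry/Shioda1982`; the levels `m = 10p = 2·5·p` of the series `PicardNumber*.lean` /
`HodgeQuadruples*Prime.lean` (Shioda 1982, Lemma 1 / Prop. 4 (Q′) and Aoki–Shioda 1983, Theorem (𝔅²ₘ) (ii)). THEOREM (no named
fact, no `sorry`): **`classify_hodgeMultiset_tenPrime`** — a pair-free Hodge `4`-multiset `s` over `ℤ/10p`, `p ≥ 19` prime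
(`IsHodgeMultiset s`, Shioda's semigroup condition), is `{x, x + 5p, −2x, 5p}` or `{x, x + 5p, 2x + 5p, −4x}` for some residue
`x` (the multisets of values of Shioda's `αᵢ, βᵢ` with `m′ = 5p`; `3 ∤ m`, so there is no `γ`, and the level `10` carries no
exceptional quadruple) [cite: Shioda1982PicardFermat, §4 Lemma 1 (a) p. 728, Prop. 4 (Q′) p. 729, table p. 727 (Δ(10) = −2)];
[cite: AokiShioda1983, §2 Theorem (𝔅²ₘ) (ii) a), b)]. The bound `p ≥ 19` (`m ≥ 190 > 180`, the range of Aoki–Shioda's clause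
"exceptional elements exist only for `m ≤ 180`") is where one counting step of the proof starts to work; the statement also holds
at `p = 11, 13, 17` (cell `pub-hfermat`, brute force), not covered here, and fails at `p = 3` (the exceptional level `30`) and
`p = 7` (the lifts of the exceptional quadruples of level `14`).

## The proof (ours — Koblitz–Ogus in Chinese-remainder coordinates; NOT the printed inductive-structure argument)

Identify `ℤ/10p ≅ ℤ/10 × ℤ/p`, `w ↔ (u, c)`. The tree's `KoblitzOgusRelationsTenPrime` supplies, for the multiplicity function of
a Hodge multiset, the odd relations `R¹(c) = 0`, `R^χ(c) = 0` and the constancy of the even family `Γ(c)` (`c ≠ 0`)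
[cite: Deligne1982HodgeCycles, Rem. 7.16 (a)] [cite: Aoki1983, Prop. 2.2] (`rels_of_isHodgeMultiset`). For a `4`-element multiset
and `p ≥ 19` some parameter `c₀` has no member on the fibres `±c₀, ±2c₀`, so `Γ ≡ 0` (`exists_free`, `rels0_of_rels`). Cases:
(F) all members in the fibre `pℤ/10p`: the level `10` (a kernel enumeration, `fibre_zero`); (Z) all members `≡ 0 (mod 5)`:
`s = 5·s′` with `s′` a pair-free Hodge quadruple of level `2p` (`isHodgeMultiset_map_liftBy_iff`), classified by the tree's
`exists_perm_std_twicePrime` (`case_five`); (U) a member of unit residue `u ∈ {1, 3, 7, 9}` mod `10` off the fibre `0`: choose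
one, `q₁ = (u₁, 2h)`, with no unit-type member over `±4h` (`top_exists`: otherwise five members would be distinct); the relations
`Γ`, `R^χ` at the parameters `h, 2h`, evaluated member by member (`tok_contrib`), only see the members over `±h, ±2h, ±4h`
("tokens"), and together with pair-freeness and `Σ = 0` they leave a finite problem over `ℤ/10 × {±1, ±2, ±4}` settled by a
kernel enumeration (`enumU`: the other members are `(u₁ + 5, 2h), (−2u₁, −4h)` and an invisible one, or `(v, h), (−2u₁, −4h)`
and an invisible one with `2v = u₁ + 5`); `Σ = 0` then fixes the invisible member, giving `α` or `β` (`caseU`); (E) no unit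
type but an even residue off the fibre `0`: the same enumeration has no solution (`enumE`, `caseE`); otherwise the members off
the fibre `0` have residues in `{0, 5}`: one such member contradicts `Σ = 0`, two are killed by `Γ`, `R¹` (`two_off`), and three
or four put every residue in `{0, 5}`, case (Z). Numerical companions (cell `pub-hfermat`, outside Lean):
`code/lit/picard/rel10p.py`, `brute10p.py` (the pair-free Hodge `4`-multisets of the levels `110, 130, 170, 190` are exactly the
`5p − 1` multisets `α_x` and the `5p − 1` multisets `β_x`; all four relation families and `Γ ≡ 0` hold on every Hodge
`4`-multiset there; `|𝔍²_{10p}| = 24(10p − 4)`).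

HONEST FRAMING (cell `pub-hfermat`): explicit algebraic cycles for specific Hodge classes on Fermat/Delsarte varieties; residual open
instances listed; no claim on general Hodge. (This file reproduces a printed structure theorem; the proof route is this formalisation's.)
-/

namespace Literature.AlgebraicGeometry.Shioda1982

open Finset Multiset
open Literature.AlgebraicGeometry.HodgeTheory Literature.AlgebraicGeometry.HodgeTheory.FermatCharacter

section TenPrime

variable {p : ℕ}

set_option linter.unusedSimpArgs false -- uniform simp sets across the case analyses (as in `HodgeQuadruplesTwelvePrime`)

/-! ### `ℤ/10p ≅ ℤ/10 × ℤ/p`: Chinese-remainder coordinates -/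

/-- `(10, p) = 1` for a prime `p ≥ 7`. [folklore] -/
private theorem coprime_ten (hp : p.Prime) (h7 : 7 ≤ p) : Nat.Coprime 10 p := by
  have h2 : Nat.Coprime 2 p := (Nat.coprime_primes Nat.prime_two hp).2 (by omega)
  have h5 : Nat.Coprime 5 p := (Nat.coprime_primes (by decide) hp).2 (by omega)
  exact Nat.Coprime.mul_left h2 h5

/-- The Chinese-remainder isomorphism `ℤ/10p ≃+* ℤ/10 × ℤ/p`. [folklore] -/
private def crt (h : Nat.Coprime 10 p) : ZMod (10 * p) ≃+* ZMod 10 × ZMod p := ZMod.chineseRemainder h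

/-- `crtPt10` is the inverse of `crt`. [folklore] -/
private theorem crtPt_eq (h : Nat.Coprime 10 p) (e : ZMod 10) (b : ZMod p) : crtPt10 h e b = (crt h).symm (e, b) := rfl

/-- First coordinate = residue mod `10`. [folklore] -/
private theorem crt_fst (h : Nat.Coprime 10 p) [NeZero (10 * p)] (w : ZMod (10 * p)) :
    (crt h w).1 = (w.val : ZMod 10) := by
  conv_lhs => rw [← ZMod.natCast_zmod_val w]
  rw [map_natCast, Prod.fst_natCast]

/-- Second coordinate = residue mod `p`. [folklore] -/
private theorem crt_snd (h : Nat.Coprime 10 p) [NeZero (10 * p)] (w : ZMod (10 * p)) :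
    (crt h w).2 = (w.val : ZMod p) := by
  conv_lhs => rw [← ZMod.natCast_zmod_val w]
  rw [map_natCast, Prod.snd_natCast]

/-- `crt (pt e b) = (e, b)`. [folklore] -/
private theorem crt_pt (h : Nat.Coprime 10 p) (e : ZMod 10) (b : ZMod p) : crt h (crtPt10 h e b) = (e, b) :=
  (crt h).apply_symm_apply (e, b)

/-- `pt (crt w) = w`. [folklore] -/
private theorem pt_crt (h : Nat.Coprime 10 p) (w : ZMod (10 * p)) : crtPt10 h (crt h w).1 (crt h w).2 = w :=
  (crt h).symm_apply_apply w

/-- `pt` is injective. [folklore] -/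
private theorem pt_inj (h : Nat.Coprime 10 p) {e e' : ZMod 10} {b b' : ZMod p} :
    crtPt10 h e b = crtPt10 h e' b' ↔ e = e' ∧ b = b' := by
  rw [crtPt_eq, crtPt_eq, (crt h).symm.injective.eq_iff, Prod.mk.injEq]

/-- `pt` is additive. [folklore] -/
private theorem pt_add (h : Nat.Coprime 10 p) (e e' : ZMod 10) (b b' : ZMod p) :
    crtPt10 h e b + crtPt10 h e' b' = crtPt10 h (e + e') (b + b') := by
  rw [crtPt_eq, crtPt_eq, crtPt_eq, ← (crt h).symm.map_add, Prod.mk_add_mk]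

/-- `pt` and negation. [folklore] -/
private theorem neg_pt (h : Nat.Coprime 10 p) (e : ZMod 10) (b : ZMod p) : -crtPt10 h e b = crtPt10 h (-e) (-b) := by
  rw [crtPt_eq, crtPt_eq, ← (crt h).symm.map_neg, Prod.neg_mk]

/-- `pt` and natural multiples. [folklore] -/
private theorem natCast_mul_pt (h : Nat.Coprime 10 p) (k : ℕ) (e : ZMod 10) (b : ZMod p) :
    (k : ZMod (10 * p)) * crtPt10 h e b = crtPt10 h (k * e) (k * b) := by
  rw [crtPt_eq, crtPt_eq, ← nsmul_eq_mul, ← _root_.map_nsmul, Prod.smul_mk, nsmul_eq_mul, nsmul_eq_mul]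

/-- `pt 0 0 = 0`. [folklore] -/
private theorem pt_zero (h : Nat.Coprime 10 p) : crtPt10 h 0 0 = 0 := by
  rw [crtPt_eq]
  exact _root_.map_zero (crt h).symm

/-- The coordinates of a natural number. [folklore] -/
private theorem crt_natCast (h : Nat.Coprime 10 p) (n : ℕ) : crt h n = ((n : ZMod 10), (n : ZMod p)) := by
  rw [map_natCast]; rfl

/-- `⟨w⟩ mod 5` from the first coordinate. [folklore] -/
private theorem fst_val_mod_five (h : Nat.Coprime 10 p) [NeZero (10 * p)] (w : ZMod (10 * p)) :
    (crt h w).1.val % 5 = w.val % 5 := by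
  rw [crt_fst, ZMod.val_natCast, Nat.mod_mod_of_dvd _ (by norm_num : 5 ∣ 10)]

/-- `p ∣ ⟨w⟩` iff the second coordinate vanishes. [folklore] -/
private theorem snd_eq_zero_iff (h : Nat.Coprime 10 p) [NeZero (10 * p)] (w : ZMod (10 * p)) :
    (crt h w).2 = 0 ↔ p ∣ w.val := by
  rw [crt_snd, ZMod.natCast_eq_zero_iff]

/-! ### Small multiples in `ℤ/p` -/

/-- `p ∤ n` for `0 < n < 19 ≤ p`. [folklore] -/
private theorem nd_small (h19 : 19 ≤ p) {n : ℕ} (hn0 : 0 < n) (hn : n < 19) : ¬ p ∣ n := fun hd ↦ by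
  have := Nat.le_of_dvd hn0 hd; omega

/-- `p ∤ ab` for `p ∤ a`, `p ∤ b`. [folklore] -/
private theorem nd_mul (hp : p.Prime) {a b : ℕ} (ha : ¬ p ∣ a) (hb : ¬ p ∣ b) : ¬ p ∣ a * b := fun hd ↦ by
  rcases (Nat.Prime.dvd_mul hp).1 hd with hd | hd
  · exact ha hd
  · exact hb hd

/-- `i·z ≠ j·z` for `z ≠ 0` in `ℤ/p` when `p ∤ |i − j|`. [folklore] -/
private theorem kne (hp : p.Prime) {z : ZMod p} (hz : z ≠ 0) {i j : ℤ} (hij : ¬ p ∣ (i - j).natAbs) :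
    (i : ZMod p) * z ≠ (j : ZMod p) * z := by
  haveI := Fact.mk hp
  intro h
  have h1 : ((i - j : ℤ) : ZMod p) * z = 0 := by push_cast; linear_combination h
  rcases mul_eq_zero.1 h1 with h2 | h2
  · rw [ZMod.intCast_zmod_eq_zero_iff_dvd] at h2
    exact hij (Int.natCast_dvd.1 h2)
  · exact hz h2

/-- `k·z ≠ 0` for `z ≠ 0` and `p ∤ k`. [folklore] -/
private theorem kne0 (hp : p.Prime) {z : ZMod p} (hz : z ≠ 0) {k : ℕ} (hk : ¬ p ∣ k) : (k : ZMod p) * z ≠ 0 := by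
  haveI := Fact.mk hp
  intro h
  rcases mul_eq_zero.1 h with h2 | h2
  · rw [ZMod.natCast_eq_zero_iff] at h2; exact hk h2
  · exact hz h2

/-- `2` is invertible in `ℤ/p`, `p` odd prime: every `y` is `2c`. [folklore] -/
private theorem exists_half (hp : p.Prime) (h19 : 19 ≤ p) (y : ZMod p) : ∃ c : ZMod p, y = 2 * c := by
  haveI := Fact.mk hp
  have h2 : (2 : ZMod p) ≠ 0 := by exact_mod_cast kne0 hp (one_ne_zero) (k := 2) (nd_small h19 (by norm_num) (by norm_num))
  exact ⟨2⁻¹ * y, by rw [mul_inv_cancel_left₀ h2]⟩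

/-- Every `y` is `5c` in `ℤ/p`, `p ≠ 5` prime. [folklore] -/
private theorem exists_fifth (hp : p.Prime) (h19 : 19 ≤ p) (y : ZMod p) : ∃ c : ZMod p, y = 5 * c := by
  haveI := Fact.mk hp
  have h5 : (5 : ZMod p) ≠ 0 := by exact_mod_cast kne0 hp (one_ne_zero) (k := 5) (nd_small h19 (by norm_num) (by norm_num))
  exact ⟨5⁻¹ * y, by rw [mul_inv_cancel_left₀ h5]⟩

/-! ### The odd counts in coordinates and the four relations -/

/-- The odd part of the multiplicity function of `T : Multiset (ℤ/10 × ℤ/p)`: `o(q) = #_q T − #_{−q} T`. [folklore] -/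
private def oc (T : Multiset (ZMod 10 × ZMod p)) (q : ZMod 10 × ZMod p) : ℤ := (count q T : ℤ) - count (-q) T

/-- `oddCt s (pt e c)` is the odd part of `s.map crt` at `(e, c)`. [folklore] -/
private theorem oddCt_eq_oc (h : Nat.Coprime 10 p) (s : Multiset (ZMod (10 * p))) (e : ZMod 10) (c : ZMod p) :
    oddCt s (crtPt10 h e c) = oc (s.map (crt h)) (e, c) := by
  classical
  have hc : ∀ q : ZMod 10 × ZMod p, count q (s.map (crt h)) = count ((crt h).symm q) s := fun q ↦ by
    rw [← Multiset.count_map_eq_count' _ _ (crt h).symm.injective, Multiset.map_map]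
    simp only [Function.comp_def, RingEquiv.symm_apply_apply, Multiset.map_id']
  have hneg : -(crt h).symm (e, c) = (crt h).symm (-e, -c) := by rw [← map_neg, Prod.neg_mk]
  simp only [oddCt, oc, hc, crtPt_eq, hneg, Prod.neg_mk]

variable (T : Multiset (ZMod 10 × ZMod p))

/-- The first relation in coordinates (fibres `c, 2c, 5c, 10c`), written out. [folklore] -/
private def cR1 (c : ZMod p) : ℤ :=
  oc T (1, c) - oc T (1, 2 * c) - oc T (1, 5 * c) + oc T (1, 10 * c) + oc T (3, c) - oc T (3, 2 * c) - oc T (3, 5 *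
    c) + oc T (3, 10 * c) + oc T (7, c) - oc T (7, 2 * c) - oc T (7, 5 * c) + oc T (7, 10 * c) + oc T (9, c) - oc T
    (9, 2 * c) - oc T (9, 5 * c) + oc T (9, 10 * c) + oc T (2, 2 * c) - oc T (2, 10 * c) + oc T (4, 2 * c) - oc T
    (4, 10 * c) + oc T (6, 2 * c) - oc T (6, 10 * c) + oc T (8, 2 * c) - oc T (8, 10 * c) + 4 * oc T (5, 5 * c) - 4
    * oc T (5, 10 * c) + 4 * oc T (0, 10 * c)

/-- The second relation (`χ₅`) in coordinates (fibres `c, 2c`). [folklore] -/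
private def cRchi (c : ZMod p) : ℤ :=
  oc T (1, c) + oc T (9, c) - oc T (3, c) - oc T (7, c) + oc T (1, 2 * c) + oc T (9, 2 * c) - oc T (3, 2 * c) - oc T
    (7, 2 * c) + oc T (2, 2 * c) + oc T (8, 2 * c) - oc T (4, 2 * c) - oc T (6, 2 * c)

/-- `Re Γ(c)` in coordinates. [folklore] -/
private def cGRe (c : ZMod p) : ℤ :=
  oc T (1, c) - oc T (9, c) - oc T (7, 2 * c) + oc T (3, 2 * c) + oc T (2, 2 * c) - oc T (8, 2 * c)

/-- `Im Γ(c)` in coordinates. [folklore] -/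
private def cGIm (c : ZMod p) : ℤ :=
  oc T (7, c) - oc T (3, c) + oc T (1, 2 * c) - oc T (9, 2 * c) + oc T (4, 2 * c) - oc T (6, 2 * c)

/-- The four relation families on the coordinates of a Hodge multiset of level `10p`. [folklore] -/
private structure Rels (T : Multiset (ZMod 10 × ZMod p)) : Prop where
  rel1 : ∀ c : ZMod p, c ≠ 0 → cR1 T c = 0
  relchi : ∀ c : ZMod p, c ≠ 0 → cRchi T c = 0
  gre : ∀ c c' : ZMod p, c ≠ 0 → c' ≠ 0 → cGRe T c = cGRe T c'
  gim : ∀ c c' : ZMod p, c ≠ 0 → c' ≠ 0 → cGIm T c = cGIm T c'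

/-- The relations with `Γ ≡ 0`. [folklore] -/
private structure Rels0 (T : Multiset (ZMod 10 × ZMod p)) : Prop where
  rel1 : ∀ c : ZMod p, c ≠ 0 → cR1 T c = 0
  relchi : ∀ c : ZMod p, c ≠ 0 → cRchi T c = 0
  gre : ∀ c : ZMod p, c ≠ 0 → cGRe T c = 0
  gim : ∀ c : ZMod p, c ≠ 0 → cGIm T c = 0

variable {T}

/-- **The relations for the coordinates of a Hodge multiset of level `10p`** (the tree's `relOne/relChi5/gammaRe/gammaIm_tenPrime`).
[cite: Deligne1982HodgeCycles, Rem. 7.16 (a)] [cite: Aoki1983, Prop. 2.2] -/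
private theorem rels_of_isHodgeMultiset (h : Nat.Coprime 10 p) [NeZero (10 * p)] (hp : p.Prime) (h7 : 7 ≤ p)
    {s : Multiset (ZMod (10 * p))} (hs : IsHodgeMultiset s) : Rels (s.map (crt h)) := by
  refine ⟨fun c hc ↦ ?_, fun c hc ↦ ?_, fun c c' hc hc' ↦ ?_, fun c c' hc hc' ↦ ?_⟩
  · have key := relOne_tenPrime hp h7 h hs hc
    simp only [oddCt_eq_oc] at key
    simpa [cR1] using key
  · have key := relChi5_tenPrime hp h7 h hs hc
    simp only [oddCt_eq_oc] at key
    simpa [cRchi] using key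
  · have key := gammaRe_tenPrime hp h7 h hs hc hc'
    simp only [gammaReSum10, oddCt_eq_oc] at key
    simpa [cGRe] using key
  · have key := gammaIm_tenPrime hp h7 h hs hc hc'
    simp only [gammaImSum10, oddCt_eq_oc] at key
    simpa [cGIm] using key

/-! ### `Γ ≡ 0`: a parameter whose fibres carry no member -/

/-- `o(u, x) = 0` when no member lies over `±x`. [folklore] -/
private theorem oc_eq_zero_of_free {T : Multiset (ZMod 10 × ZMod p)} {x : ZMod p}
    (hx : ∀ q ∈ T, q.2 ≠ x ∧ q.2 ≠ -x) (u : ZMod 10) : oc T (u, x) = 0 := by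
  classical
  have h1 : count (u, x) T = 0 := Multiset.count_eq_zero.mpr fun hm ↦ (hx _ hm).1 rfl
  have h2 : count (-u, -x) T = 0 := Multiset.count_eq_zero.mpr fun hm ↦ (hx _ hm).2 rfl
  simp [oc, Prod.neg_mk, h1, h2]

/-- **For a `4`-element coordinate multiset and `p ≥ 19` some `c₀ ≠ 0` has no member over `±c₀, ±2c₀`** (at most `16`
parameters are excluded). [folklore] -/
private theorem exists_free (hp : p.Prime) (h19 : 19 ≤ p) (T : Multiset (ZMod 10 × ZMod p)) (hT : card T = 4) :
    ∃ c : ZMod p, c ≠ 0 ∧ (∀ q ∈ T, q.2 ≠ c ∧ q.2 ≠ -c) ∧ ∀ q ∈ T, q.2 ≠ 2 * c ∧ q.2 ≠ -(2 * c) := by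
  classical
  haveI := Fact.mk hp
  have h2 : (2 : ZMod p) ≠ 0 := by exact_mod_cast kne0 hp (one_ne_zero) (k := 2) (nd_small h19 (by norm_num) (by norm_num))
  let B : Finset (ZMod p) := {0} ∪ ((T.map fun q ↦ q.2).toFinset ∪ (T.map fun q ↦ -q.2).toFinset ∪
      ((T.map fun q ↦ 2⁻¹ * q.2).toFinset ∪ (T.map fun q ↦ -(2⁻¹ * q.2)).toFinset))
  have hB : B.card ≤ 17 := by
    have c1 : ∀ g : ZMod 10 × ZMod p → ZMod p, ((T.map g).toFinset).card ≤ 4 := fun g ↦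
      (Multiset.toFinset_card_le _).trans (by rw [Multiset.card_map, hT])
    calc B.card ≤ ({0} : Finset (ZMod p)).card + (((T.map fun q ↦ q.2).toFinset ∪ (T.map fun q ↦ -q.2).toFinset ∪
          ((T.map fun q ↦ 2⁻¹ * q.2).toFinset ∪ (T.map fun q ↦ -(2⁻¹ * q.2)).toFinset))).card := Finset.card_union_le _ _
      _ ≤ 1 + (4 + 4 + (4 + 4)) := by
          gcongr
          · simp
          · exact (Finset.card_union_le _ _).trans (add_le_add ((Finset.card_union_le _ _).trans (add_le_add (c1 _) (c1 _)))
              ((Finset.card_union_le _ _).trans (add_le_add (c1 _) (c1 _))))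
      _ = 17 := by norm_num
  by_contra hcon
  push Not at hcon
  have hsub : (Finset.univ : Finset (ZMod p)) ⊆ B := by
    intro c _
    by_cases hc0 : c = 0
    · simp [B, hc0]
    have hc := hcon c hc0
    simp only [B, Finset.mem_union, Finset.mem_singleton, Multiset.mem_toFinset, Multiset.mem_map]
    by_cases hA : ∀ q ∈ T, q.2 ≠ c ∧ q.2 ≠ -c
    · obtain ⟨q, hq, hq'⟩ := hc hA
      by_cases e1 : q.2 = 2 * c
      · right; right; left; exact ⟨q, hq, by rw [e1, inv_mul_cancel_left₀ h2]⟩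
      · have e2 : q.2 = -(2 * c) := hq' e1
        right; right; right; exact ⟨q, hq, by rw [e2, mul_neg, inv_mul_cancel_left₀ h2, neg_neg]⟩
    · push Not at hA
      obtain ⟨q, hq, hq'⟩ := hA
      by_cases e1 : q.2 = c
      · right; left; left; exact ⟨q, hq, e1⟩
      · right; left; right; exact ⟨q, hq, by rw [hq' e1, neg_neg]⟩
  have := Finset.card_le_card hsub
  rw [Finset.card_univ, ZMod.card] at this
  omega

/-- **`Γ ≡ 0`** for a `4`-element coordinate multiset with the relations, `p ≥ 19`. [folklore] -/
private theorem rels0_of_rels (hp : p.Prime) (h19 : 19 ≤ p) {T : Multiset (ZMod 10 × ZMod p)} (hT : card T = 4)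
    (hR : Rels T) : Rels0 T := by
  obtain ⟨c₀, hc₀, hA, hB⟩ := exists_free hp h19 T hT
  have hre : cGRe T c₀ = 0 := by simp only [cGRe, oc_eq_zero_of_free hA, oc_eq_zero_of_free hB]; ring
  have him : cGIm T c₀ = 0 := by simp only [cGIm, oc_eq_zero_of_free hA, oc_eq_zero_of_free hB]; ring
  exact ⟨hR.rel1, hR.relchi, fun c hc ↦ by rw [hR.gre c c₀ hc hc₀, hre], fun c hc ↦ by rw [hR.gim c c₀ hc hc₀, him]⟩

/-! ### Evaluating the relations on explicit multisets: member contributions -/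

/-- The indicator `[k = e]` as an integer. [folklore] -/
private def ind (k e : ZMod 10) : ℤ := if k = e then 1 else 0

/-- `𝟙_U`, `U = {1, 3, 7, 9}`. [folklore] -/
private def tU (e : ZMod 10) : ℤ := ind 1 e + ind 3 e + ind 7 e + ind 9 e
/-- `𝟙_E`, `E = {2, 4, 6, 8}`. [folklore] -/
private def tE (e : ZMod 10) : ℤ := ind 2 e + ind 4 e + ind 6 e + ind 8 e
/-- Table of `R¹` at the fibre `2c`: `−𝟙_U + 𝟙_E`. [folklore] -/
private def tB1 (e : ZMod 10) : ℤ := -tU e + tE e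
/-- Table of `R¹` at the fibre `5c`: `−𝟙_U + 4[5]`. [folklore] -/
private def tC1 (e : ZMod 10) : ℤ := -tU e + 4 * ind 5 e
/-- Table of `R¹` at the fibre `10c`: `𝟙_U − 𝟙_E − 4[5] + 4[0]`. [folklore] -/
private def tD1 (e : ZMod 10) : ℤ := tU e - tE e - 4 * ind 5 e + 4 * ind 0 e
/-- Table of `R^χ` at the fibre `c`: `χ₅` on the units. [folklore] -/
private def tAchi (e : ZMod 10) : ℤ := ind 1 e + ind 9 e - ind 3 e - ind 7 e
/-- Table of `R^χ` at the fibre `2c`. [folklore] -/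
private def tBchi (e : ZMod 10) : ℤ := ind 1 e + ind 9 e - ind 3 e - ind 7 e + ind 2 e + ind 8 e - ind 4 e - ind 6 e
/-- Table of `Re Γ` at the fibre `c`. [folklore] -/
private def tARe (e : ZMod 10) : ℤ := ind 1 e - ind 9 e
/-- Table of `Re Γ` at the fibre `2c`. [folklore] -/
private def tBRe (e : ZMod 10) : ℤ := -ind 7 e + ind 3 e + ind 2 e - ind 8 e
/-- Table of `Im Γ` at the fibre `c`. [folklore] -/
private def tAIm (e : ZMod 10) : ℤ := ind 7 e - ind 3 e
/-- Table of `Im Γ` at the fibre `2c`. [folklore] -/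
private def tBIm (e : ZMod 10) : ℤ := ind 1 e - ind 9 e + ind 4 e - ind 6 e

/-- The residues of unit type. [folklore] -/
private theorem tU_cases : ∀ u : ZMod 10, tU u = 1 → u = 1 ∨ u = 3 ∨ u = 7 ∨ u = 9 := by decide

/-- The residues of even type. [folklore] -/
private theorem tE_cases : ∀ u : ZMod 10, tE u = 1 → u = 2 ∨ u = 4 ∨ u = 6 ∨ u = 8 := by decide

/-- The negatives of the residues mod `10`. [folklore] -/
private theorem neg10 : (-(0 : ZMod 10)) = 0 ∧ (-(1 : ZMod 10)) = 9 ∧ (-(2 : ZMod 10)) = 8 ∧ (-(3 : ZMod 10)) = 7 ∧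
    (-(4 : ZMod 10)) = 6 ∧ (-(5 : ZMod 10)) = 5 ∧ (-(6 : ZMod 10)) = 4 ∧ (-(7 : ZMod 10)) = 3 ∧ (-(8 : ZMod 10)) = 2 ∧
    (-(9 : ZMod 10)) = 1 := by decide

/-- `[P ∧ Q] = [P]·[Q]`. [folklore] -/
private theorem ite_and_one {P Q : Prop} [Decidable P] [Decidable Q] :
    (if P ∧ Q then (1 : ℤ) else 0) = (if P then 1 else 0) * (if Q then 1 else 0) := by
  split_ifs <;> simp_all

/-- Contribution of a member `(e, d)` to an ODD-type relation with even tables on the four fibres `c, 2c, 5c, 10c`: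
`Σ_l T_l(e)([l c = d] − [−l c = d])`. [folklore] -/
private def contrib4 (A B C D : ZMod 10 → ℤ) (c : ZMod p) (e : ZMod 10) (d : ZMod p) : ℤ :=
  A e * ((if c = d then 1 else 0) - (if -c = d then 1 else 0)) +
    B e * ((if 2 * c = d then 1 else 0) - (if -(2 * c) = d then 1 else 0)) +
    C e * ((if 5 * c = d then 1 else 0) - (if -(5 * c) = d then 1 else 0)) +
    D e * ((if 10 * c = d then 1 else 0) - (if -(10 * c) = d then 1 else 0))

/-- Contribution of a member `(e, d)` to an ODD-type relation with even tables on the fibres `c, 2c`. [folklore] -/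
private def contrib2 (A B : ZMod 10 → ℤ) (c : ZMod p) (e : ZMod 10) (d : ZMod p) : ℤ :=
  A e * ((if c = d then 1 else 0) - (if -c = d then 1 else 0)) +
    B e * ((if 2 * c = d then 1 else 0) - (if -(2 * c) = d then 1 else 0))

/-- Contribution of a member `(e, d)` to an EVEN-type relation (odd tables) on the fibres `c, 2c`:
`A(e)([c = d] + [−c = d]) + B(e)([2c = d] + [−2c = d])`. [folklore] -/
private def contribO (A B : ZMod 10 → ℤ) (c : ZMod p) (e : ZMod 10) (d : ZMod p) : ℤ :=
  A e * ((if c = d then 1 else 0) + (if -c = d then 1 else 0)) +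
    B e * ((if 2 * c = d then 1 else 0) + (if -(2 * c) = d then 1 else 0))

/-- `o` of the empty multiset. [folklore] -/
private theorem oc_zero (q : ZMod 10 × ZMod p) : oc (0 : Multiset (ZMod 10 × ZMod p)) q = 0 := by simp [oc]

/-- `o` of `a ::ₘ T`. [folklore] -/
private theorem oc_cons (a : ZMod 10 × ZMod p) (T : Multiset (ZMod 10 × ZMod p)) (q : ZMod 10 × ZMod p) :
    oc (a ::ₘ T) q = oc T q + ((if q = a then 1 else 0) - (if -q = a then 1 else 0)) := by
  simp only [oc, Multiset.count_cons, Nat.cast_add, Nat.cast_ite, Nat.cast_one, Nat.cast_zero]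
  ring

/-- The contribution of a member to `R¹(c)`. [folklore] -/
private theorem cR1_cons (e : ZMod 10) (d : ZMod p) (T : Multiset (ZMod 10 × ZMod p)) (c : ZMod p) :
    cR1 ((e, d) ::ₘ T) c = cR1 T c + contrib4 tU tB1 tC1 tD1 c e d := by
  obtain ⟨n0, n1, n2, n3, n4, n5, n6, n7, n8, n9⟩ := neg10
  simp only [cR1, oc_cons, Prod.neg_mk, Prod.mk.injEq, ite_and_one, contrib4, tU, tE, tB1, tC1, tD1, ind,
    n0, n1, n2, n3, n4, n5, n6, n7, n8, n9]
  ring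

/-- The contribution of a member to `R^χ(c)`. [folklore] -/
private theorem cRchi_cons (e : ZMod 10) (d : ZMod p) (T : Multiset (ZMod 10 × ZMod p)) (c : ZMod p) :
    cRchi ((e, d) ::ₘ T) c = cRchi T c + contrib2 tAchi tBchi c e d := by
  obtain ⟨n0, n1, n2, n3, n4, n5, n6, n7, n8, n9⟩ := neg10
  simp only [cRchi, oc_cons, Prod.neg_mk, Prod.mk.injEq, ite_and_one, contrib2, tAchi, tBchi, ind,
    n0, n1, n2, n3, n4, n5, n6, n7, n8, n9]
  ring

/-- The contribution of a member to `Re Γ(c)`. [folklore] -/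
private theorem cGRe_cons (e : ZMod 10) (d : ZMod p) (T : Multiset (ZMod 10 × ZMod p)) (c : ZMod p) :
    cGRe ((e, d) ::ₘ T) c = cGRe T c + contribO tARe tBRe c e d := by
  obtain ⟨n0, n1, n2, n3, n4, n5, n6, n7, n8, n9⟩ := neg10
  simp only [cGRe, oc_cons, Prod.neg_mk, Prod.mk.injEq, ite_and_one, contribO, tARe, tBRe, ind,
    n0, n1, n2, n3, n4, n5, n6, n7, n8, n9]
  ring

/-- The contribution of a member to `Im Γ(c)`. [folklore] -/
private theorem cGIm_cons (e : ZMod 10) (d : ZMod p) (T : Multiset (ZMod 10 × ZMod p)) (c : ZMod p) :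
    cGIm ((e, d) ::ₘ T) c = cGIm T c + contribO tAIm tBIm c e d := by
  obtain ⟨n0, n1, n2, n3, n4, n5, n6, n7, n8, n9⟩ := neg10
  simp only [cGIm, oc_cons, Prod.neg_mk, Prod.mk.injEq, ite_and_one, contribO, tAIm, tBIm, ind,
    n0, n1, n2, n3, n4, n5, n6, n7, n8, n9]
  ring

/-- The relations vanish on the empty multiset. [folklore] -/
private theorem cR_zero (c : ZMod p) :
    cR1 (0 : Multiset (ZMod 10 × ZMod p)) c = 0 ∧ cRchi (0 : Multiset (ZMod 10 × ZMod p)) c = 0 ∧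
      cGRe (0 : Multiset (ZMod 10 × ZMod p)) c = 0 ∧ cGIm (0 : Multiset (ZMod 10 × ZMod p)) c = 0 := by
  simp [cR1, cRchi, cGRe, cGIm, oc_zero]

/-- The four relations of an explicit `4`-multiset as sums of member contributions. [folklore] -/
private theorem cR_four (q₁ q₂ q₃ q₄ : ZMod 10 × ZMod p) (c : ZMod p) :
    cR1 ({q₁, q₂, q₃, q₄} : Multiset (ZMod 10 × ZMod p)) c = contrib4 tU tB1 tC1 tD1 c q₁.1 q₁.2 +
        contrib4 tU tB1 tC1 tD1 c q₂.1 q₂.2 + contrib4 tU tB1 tC1 tD1 c q₃.1 q₃.2 + contrib4 tU tB1 tC1 tD1 c q₄.1 q₄.2 ∧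
      cRchi ({q₁, q₂, q₃, q₄} : Multiset (ZMod 10 × ZMod p)) c = contrib2 tAchi tBchi c q₁.1 q₁.2 +
        contrib2 tAchi tBchi c q₂.1 q₂.2 + contrib2 tAchi tBchi c q₃.1 q₃.2 + contrib2 tAchi tBchi c q₄.1 q₄.2 ∧
      cGRe ({q₁, q₂, q₃, q₄} : Multiset (ZMod 10 × ZMod p)) c = contribO tARe tBRe c q₁.1 q₁.2 +
        contribO tARe tBRe c q₂.1 q₂.2 + contribO tARe tBRe c q₃.1 q₃.2 + contribO tARe tBRe c q₄.1 q₄.2 ∧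
      cGIm ({q₁, q₂, q₃, q₄} : Multiset (ZMod 10 × ZMod p)) c = contribO tAIm tBIm c q₁.1 q₁.2 +
        contribO tAIm tBIm c q₂.1 q₂.2 + contribO tAIm tBIm c q₃.1 q₃.2 + contribO tAIm tBIm c q₄.1 q₄.2 := by
  obtain ⟨e₁, d₁⟩ := q₁; obtain ⟨e₂, d₂⟩ := q₂; obtain ⟨e₃, d₃⟩ := q₃; obtain ⟨e₄, d₄⟩ := q₄
  simp only [Multiset.insert_eq_cons, ← Multiset.cons_zero (e₄, d₄)]
  obtain ⟨z1, z2, z3, z4⟩ := cR_zero (p := p) c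
  refine ⟨?_, ?_, ?_, ?_⟩
  · rw [cR1_cons, cR1_cons, cR1_cons, cR1_cons, z1]; ring
  · rw [cRchi_cons, cRchi_cons, cRchi_cons, cRchi_cons, z2]; ring
  · rw [cGRe_cons, cGRe_cons, cGRe_cons, cGRe_cons, z3]; ring
  · rw [cGIm_cons, cGIm_cons, cGIm_cons, cGIm_cons, z4]; ring

/-- A member in the fibre `0` contributes nothing (all relation fibres are `≠ 0` for `c ≠ 0`). [folklore] -/
private theorem contrib_fibre_zero (hp : p.Prime) (h19 : 19 ≤ p) {c : ZMod p} (hc : c ≠ 0) (e : ZMod 10) :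
    (∀ A B C D : ZMod 10 → ℤ, contrib4 A B C D c e 0 = 0) ∧ (∀ A B : ZMod 10 → ℤ, contrib2 A B c e 0 = 0) ∧
      ∀ A B : ZMod 10 → ℤ, contribO A B c e 0 = 0 := by
  haveI := Fact.mk hp
  have h2 : (2 : ZMod p) * c ≠ 0 := by exact_mod_cast kne0 hp hc (k := 2) (nd_small h19 (by norm_num) (by norm_num))
  have h5 : (5 : ZMod p) * c ≠ 0 := by exact_mod_cast kne0 hp hc (k := 5) (nd_small h19 (by norm_num) (by norm_num))
  have h10 : (10 : ZMod p) * c ≠ 0 := by exact_mod_cast kne0 hp hc (k := 10) (nd_small h19 (by norm_num) (by norm_num))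
  have n1 : -c ≠ 0 := neg_ne_zero.2 hc
  have n2 : -(2 * c) ≠ 0 := neg_ne_zero.2 h2
  have n5 : -(5 * c) ≠ 0 := neg_ne_zero.2 h5
  have n10 : -(10 * c) ≠ 0 := neg_ne_zero.2 h10
  refine ⟨fun A B C D ↦ ?_, fun A B ↦ ?_, fun A B ↦ ?_⟩
  · simp only [contrib4, if_neg hc, if_neg n1, if_neg h2, if_neg n2, if_neg h5, if_neg n5, if_neg h10, if_neg n10]; ring
  · simp only [contrib2, if_neg hc, if_neg n1, if_neg h2, if_neg n2]; ring
  · simp only [contribO, if_neg hc, if_neg n1, if_neg h2, if_neg n2]; ring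

/-! ### Hodge multisets of a lower level lifted along `k ↦ ⟨k⟩·d : ℤ/n → ℤ/nd` -/

section Lift

variable {m n d : ℕ} [NeZero m] [NeZero n]

/-- The lift `k ↦ ⟨k⟩·d : ℤ/n → ℤ/m`, `m = n d` (an additive embedding onto `dℤ/m`). [cite: Shioda1982PicardFermat, §2 p. 726 (𝔍ₘ(d) ≅ 𝔍_{m/d}(1))] -/
def liftBy (m n d : ℕ) (k : ZMod n) : ZMod m := ((k.val * d : ℕ) : ZMod m)

/-- `⟨liftBy k⟩ = ⟨k⟩ d`. [folklore] -/
private theorem val_liftBy (hm : m = n * d) (k : ZMod n) : (liftBy m n d k).val = k.val * d := by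
  rw [liftBy, ZMod.val_natCast, Nat.mod_eq_of_lt (by rw [hm]; have := ZMod.val_lt k; have := NeZero.pos m; nlinarith)]

/-- `liftBy` is injective (`d > 0`). [folklore] -/
private theorem liftBy_injective (hm : m = n * d) (hd : 0 < d) : Function.Injective (liftBy m n d) := by
  intro a b h
  have := congrArg ZMod.val h
  rw [val_liftBy hm, val_liftBy hm] at this
  exact ZMod.val_injective n (Nat.eq_of_mul_eq_mul_right hd this)

omit [NeZero n] in
/-- `w · liftBy k = liftBy ((w mod n)·k)`. [folklore] -/
private theorem mul_liftBy (hm : m = n * d) (w : ZMod m) (k : ZMod n) :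
    w * liftBy m n d k = liftBy m n d (ZMod.castHom (show n ∣ m from ⟨d, hm⟩) (ZMod n) w * k) := by
  subst hm
  rw [liftBy, liftBy, ZMod.castHom_apply, ZMod.cast_eq_val]
  conv_lhs => rw [← ZMod.natCast_zmod_val w]
  rw [← Nat.cast_mul, ZMod.natCast_eq_natCast_iff, ZMod.val_mul, ZMod.val_natCast]
  have e0 : (w.val % n * k.val) % n = (w.val * k.val) % n := by
    rw [Nat.mul_mod (w.val % n) k.val n, Nat.mod_mod, Nat.mul_mod w.val k.val n]
  have e1 : (w.val * k.val) % n * d = (w.val * (k.val * d)) % (n * d) := by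
    rw [← Nat.mul_assoc, Nat.mul_mod_mul_right]
  rw [e0, e1]
  exact (Nat.mod_modEq _ _).symm

omit [NeZero m] in
/-- `liftBy` is additive. [folklore] -/
private theorem liftBy_add (hm : m = n * d) (a b : ZMod n) : liftBy m n d (a + b) = liftBy m n d a + liftBy m n d b := by
  rw [liftBy, liftBy, liftBy, ← Nat.cast_add, ZMod.natCast_eq_natCast_iff, hm, ZMod.val_add, ← Nat.add_mul,
    ← Nat.mul_mod_mul_right]
  exact Nat.mod_modEq _ _

omit [NeZero m] [NeZero n] in
/-- `liftBy 0 = 0`. [folklore] -/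
private theorem liftBy_zero : liftBy m n d 0 = 0 := by
  simp [liftBy]

omit [NeZero n] in
/-- Every residue in `dℤ/m` is a lift. [folklore] -/
private theorem liftBy_div (hm : m = n * d) (hd : 0 < d) {w : ZMod m} (hw : d ∣ w.val) :
    liftBy m n d ((w.val / d : ℕ) : ZMod n) = w := by
  have hlt : w.val / d < n := by
    rw [Nat.div_lt_iff_lt_mul hd]; exact lt_of_lt_of_eq (ZMod.val_lt w) hm
  rw [liftBy, ZMod.val_natCast, Nat.mod_eq_of_lt hlt, Nat.div_mul_cancel hw, ZMod.natCast_zmod_val]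

/-- The norm sums of a lifted multiset: `Σ⟨w·liftBy k⟩ = d·Σ⟨w̄ k⟩`, `w̄ = w mod n`. [folklore] -/
private theorem mNormSum_map_liftBy (hm : m = n * d) (M : Multiset (ZMod n)) (w : ZMod m) :
    mNormSum ((M.map (liftBy m n d)).map fun a ↦ w * a) =
      d * mNormSum (M.map fun k ↦ ZMod.castHom (show n ∣ m from ⟨d, hm⟩) (ZMod n) w * k) := by
  rw [mNormSum, mNormSum, Multiset.map_map, Multiset.map_map, Multiset.map_map]
  have e : ∀ k ∈ M, ((ZMod.val ∘ fun a ↦ w * a) ∘ liftBy m n d) k =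
      (fun k ↦ (ZMod.val ∘ fun k ↦ ZMod.castHom (show n ∣ m from ⟨d, hm⟩) (ZMod n) w * k) k * d) k := fun k _ ↦ by
    simp only [Function.comp_apply, mul_liftBy hm, val_liftBy hm]
  rw [Multiset.map_congr rfl e, Multiset.sum_map_mul_right, mul_comm]

/-- **Hodge multisets of level `n` lift to Hodge multisets of level `m = nd` and conversely** (`𝔍ₘ(d) ≅ 𝔍_{m/d}(1)` at the
level of Shioda's condition: a unit `w` of `ℤ/m` acts on `d·M` as `w mod n` acts on `M`, and every unit of `ℤ/n` is such a
reduction). [cite: Shioda1982PicardFermat, §2 p. 726] [cite: Shioda1979PJA, §1 eq. (2)] -/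
theorem isHodgeMultiset_map_liftBy_iff (hm : m = n * d) (hd : 0 < d) (M : Multiset (ZMod n)) :
    IsHodgeMultiset (M.map (liftBy m n d)) ↔ IsHodgeMultiset M := by
  classical
  have hnm : n ∣ m := ⟨d, hm⟩
  have hsum : (M.map (liftBy m n d)).sum = 0 ↔ M.sum = 0 := by
    have e : (M.map (liftBy m n d)).sum = liftBy m n d M.sum := by
      induction M using Multiset.induction_on with
      | empty => simp [liftBy_zero]
      | cons a M ih => rw [Multiset.map_cons, Multiset.sum_cons, Multiset.sum_cons, ih, liftBy_add hm]
    rw [e, ← liftBy_zero (m := m) (n := n) (d := d), (liftBy_injective hm hd).eq_iff]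
  have hne : (∀ a ∈ M.map (liftBy m n d), a ≠ 0) ↔ ∀ a ∈ M, a ≠ 0 := by
    simp only [Multiset.forall_mem_map_iff]
    refine forall₂_congr fun a _ ↦ ?_
    rw [← liftBy_zero (m := m) (n := n) (d := d), (liftBy_injective hm hd).ne_iff]
  have hcard : Multiset.card (M.map (liftBy m n d)) = Multiset.card M := Multiset.card_map _ _
  have hmn : (m : ℕ) = d * n := by rw [hm, mul_comm]
  constructor
  · rintro ⟨⟨h1, h2⟩, h3⟩
    refine ⟨⟨hne.mp h1, hsum.mp h2⟩, fun u ↦ ?_⟩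
    obtain ⟨U, hU⟩ := ZMod.unitsMap_surjective hnm u
    have key := h3 U
    rw [mNormSum_map_liftBy hm, hcard] at key
    have hUu : ZMod.castHom hnm (ZMod n) (U : ZMod m) = (u : ZMod n) := by
      rw [← hU]; simp [ZMod.unitsMap_def]
    rw [hUu, hmn] at key
    have : d * (2 * mNormSum (M.map fun k ↦ (u : ZMod n) * k)) = d * (n * Multiset.card M) := by linarith
    exact Nat.eq_of_mul_eq_mul_left hd this
  · rintro ⟨⟨h1, h2⟩, h3⟩
    refine ⟨⟨hne.mpr h1, hsum.mpr h2⟩, fun U ↦ ?_⟩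
    rw [mNormSum_map_liftBy hm, hcard]
    have hU : IsUnit (ZMod.castHom hnm (ZMod n) (U : ZMod m)) := (Units.isUnit U).map _
    obtain ⟨u, hu⟩ := hU
    rw [show ZMod.castHom _ (ZMod n) (U : ZMod m) = (u : ZMod n) from hu.symm, hmn]
    have key : d * (2 * mNormSum (M.map fun a ↦ (u : ZMod n) * a)) = d * (n * Multiset.card M) := by rw [h3 u]
    linarith

/-- A multiset all of whose members lie in `dℤ/m` is a lift; the lift is pair-free if the original is. [folklore] -/
private theorem exists_eq_map_liftBy (hm : m = n * d) (hd : 0 < d) {s : Multiset (ZMod m)} (hs : ∀ w ∈ s, d ∣ w.val) :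
    ∃ M : Multiset (ZMod n), s = M.map (liftBy m n d) ∧ Multiset.card M = Multiset.card s ∧
      ((∀ a ∈ s, ∀ b ∈ s.erase a, a + b ≠ 0) → ∀ a ∈ M, ∀ b ∈ M.erase a, a + b ≠ 0) := by
  classical
  set g : ZMod m → ZMod n := fun w ↦ ((w.val / d : ℕ) : ZMod n) with hg
  have hga : ∀ w ∈ s, liftBy m n d (g w) = w := fun w hw ↦ liftBy_div hm hd (hs w hw)
  refine ⟨s.map g, ?_, by rw [Multiset.card_map], fun hpf a ha b hb hab ↦ ?_⟩
  · rw [Multiset.map_map]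
    conv_lhs => rw [← Multiset.map_id s]
    exact Multiset.map_congr rfl fun w hw ↦ (hga w hw).symm
  · obtain ⟨a', ha', rfl⟩ := Multiset.mem_map.mp ha
    rw [← Multiset.map_erase_of_mem _ _ ha'] at hb
    obtain ⟨b', hb', rfl⟩ := Multiset.mem_map.mp hb
    have hb's : b' ∈ s := Multiset.mem_of_mem_erase hb'
    apply hpf a' ha' b' hb'
    have e : liftBy m n d (g a' + g b') = 0 := by rw [hab, liftBy_zero]
    rwa [liftBy_add hm, hga a' ha', hga b' hb's] at e

end Lift

/-! ### Case F: all members in the fibre `0` — the level `10` (a kernel enumeration) -/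

/-- `5p` as a residue mod `10p` (Shioda's `m′`). -/
local notation "K10" => (((5 * p : ℕ)) : ZMod (10 * p))

/-- The predicate "`s` is an `α`- or a `β`-multiset of level `10p`". [folklore] -/
private def IsStd (s : Multiset (ZMod (10 * p))) : Prop :=
  ∃ x : ZMod (10 * p), s = {x, x + K10, -(2 * x), K10} ∨ s = {x, x + K10, 2 * x + K10, -(4 * x)}

/-- The Boolean permutation test of two lists over `ℤ/10`. [folklore] -/
private def permB (L M : List (ZMod 10)) : Bool := (L ++ M).all fun x ↦ L.count x == M.count x

/-- The unit test mod `10`. [folklore] -/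
private def unitB (k : ZMod 10) : Bool := k == 1 || k == 3 || k == 7 || k == 9

/-- The `α`- and `β`-forms of level `10` through a base `x`, as lists. [folklore] -/
private def formsL (x : ZMod 10) : List (List (ZMod 10)) :=
  [[x, x + 5, -(2 * x), 5], [x, x + 5, 2 * x + 5, -(4 * x)]]

/-- The hypotheses of the level-`10` problem for `(k₁, k₂, k₃, k₄ = −(k₁+k₂+k₃))`: no zero entry, Shioda's norm condition
for the four units, no pair. [folklore] -/
private def levHyp (k₁ k₂ k₃ : ZMod 10) : Prop :=
  let k₄ := -(k₁ + k₂ + k₃)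
  k₁ ≠ 0 ∧ k₂ ≠ 0 ∧ k₃ ≠ 0 ∧ k₄ ≠ 0 ∧
  (∀ t : ZMod 10, unitB t = true → (t * k₁).val + (t * k₂).val + (t * k₃).val + (t * k₄).val = 20) ∧
  k₁ + k₂ ≠ 0 ∧ k₁ + k₃ ≠ 0 ∧ k₁ + k₄ ≠ 0 ∧ k₂ + k₃ ≠ 0 ∧ k₂ + k₄ ≠ 0 ∧ k₃ + k₄ ≠ 0

/-- `levHyp` is decidable. [folklore] -/
private instance (k₁ k₂ k₃ : ZMod 10) : Decidable (levHyp k₁ k₂ k₃) := by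
  unfold levHyp; infer_instance

/-- The Boolean test: under `levHyp`, the quadruple is a permutation of a form through one of its entries. [folklore] -/
private def testLev (k₁ k₂ k₃ : ZMod 10) : Bool :=
  let k₄ := -(k₁ + k₂ + k₃)
  !decide (levHyp k₁ k₂ k₃) ||
    ([k₁, k₂, k₃, k₄].any fun x ↦ (formsL x).any fun F ↦ permB F [k₁, k₂, k₃, k₄])

/-- **The kernel enumeration at level `10`.** [folklore] -/
private theorem testLev_all : ∀ k₁ k₂ k₃ : ZMod 10, testLev k₁ k₂ k₃ = true := by
  decide +kernel

/-- `permB` is sound. [folklore] -/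
private theorem perm_of_permB {L M : List (ZMod 10)} (h : permB L M = true) : (L : Multiset (ZMod 10)) = M := by
  classical
  rw [Multiset.coe_eq_coe]
  refine List.perm_iff_count.2 fun x ↦ ?_
  simp only [permB, List.all_eq_true, beq_iff_eq] at h
  by_cases hx : x ∈ L ++ M
  · exact h x hx
  · rw [List.mem_append, not_or] at hx
    rw [List.count_eq_zero_of_not_mem hx.1, List.count_eq_zero_of_not_mem hx.2]

/-- The level-`10` classification, multiset form. [folklore] -/
private theorem level_ten_forms (k₁ k₂ k₃ : ZMod 10) (H : levHyp k₁ k₂ k₃) :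
    ∃ x : ZMod 10, ({k₁, k₂, k₃, -(k₁ + k₂ + k₃)} : Multiset (ZMod 10)) = {x, x + 5, -(2 * x), 5} ∨
      ({k₁, k₂, k₃, -(k₁ + k₂ + k₃)} : Multiset (ZMod 10)) = {x, x + 5, 2 * x + 5, -(4 * x)} := by
  have h := testLev_all k₁ k₂ k₃
  simp only [testLev, decide_eq_true H, Bool.not_true, Bool.false_or, List.any_eq_true] at h
  obtain ⟨x, -, F, hF, hperm⟩ := h
  refine ⟨x, ?_⟩
  have e := perm_of_permB hperm
  simp only [formsL, List.mem_cons, List.not_mem_nil, or_false] at hF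
  have quad : (([k₁, k₂, k₃, -(k₁ + k₂ + k₃)] : List (ZMod 10)) : Multiset (ZMod 10)) = {k₁, k₂, k₃, -(k₁ + k₂ + k₃)} := rfl
  rcases hF with rfl | rfl
  · left; rw [← quad, ← e]; rfl
  · right; rw [← quad, ← e]; rfl

/-- A unit of `ℤ/10` lifts to a unit of `ℤ/10p`. [folklore] -/
private theorem exists_unit_above [NeZero (10 * p)] (hnm : 10 ∣ 10 * p) (τ : (ZMod 10)ˣ) :
    ∃ U : (ZMod (10 * p))ˣ, ZMod.castHom hnm (ZMod 10) (U : ZMod (10 * p)) = τ := by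
  obtain ⟨U, hU⟩ := ZMod.unitsMap_surjective hnm τ
  exact ⟨U, by rw [← hU]; simp [ZMod.unitsMap_def]⟩

/-- The six pair conditions of a pair-free explicit quadruple. [folklore] -/
private theorem six_pairs {X : Type*} [AddGroup X] [DecidableEq X] {s : Multiset X} {a b c d : X} (hs : s = {a, b, c, d})
    (hpf : ∀ x ∈ s, ∀ y ∈ s.erase x, x + y ≠ 0) :
    a + b ≠ 0 ∧ a + c ≠ 0 ∧ a + d ≠ 0 ∧ b + c ≠ 0 ∧ b + d ≠ 0 ∧ c + d ≠ 0 := by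
  have ea : s = a ::ₘ {b, c, d} := by rw [hs]; rfl
  have eb : s = b ::ₘ {a, c, d} := by rw [hs]; exact Multiset.cons_swap a b _
  have ec : s = c ::ₘ {a, b, d} := by
    rw [hs]; simp only [Multiset.insert_eq_cons]; rw [Multiset.cons_swap b c, Multiset.cons_swap a c]
  have mem : ∀ (x : X) (t : Multiset X), s = x ::ₘ t → ∀ y ∈ t, x + y ≠ 0 := by
    rintro x t rfl y hy
    exact hpf x (Multiset.mem_cons_self _ _) y (by rw [Multiset.erase_cons_head]; exact hy)
  exact ⟨mem a _ ea b (by simp), mem a _ ea c (by simp), mem a _ ea d (by simp), mem b _ eb c (by simp), mem b _ eb d (by simp),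
    mem c _ ec d (by simp)⟩

/-- `Σ⟨·⟩` of a singleton. [folklore] -/
private theorem mNormSum_singleton {n : ℕ} (x : ZMod n) : mNormSum ({x} : Multiset (ZMod n)) = x.val := by
  simp [mNormSum]

/-- **Case F.** All members in the fibre `pℤ/10p`: `s = p·M` with `M` a pair-free Hodge quadruple of level `10`, enumerated by
the kernel — `α_x` or `β_x` with `x ∈ pℤ/10p` (the level `10` carries no exceptional quadruple).
[cite: Shioda1982PicardFermat, table p. 727 (m = 10)] -/
private theorem fibre_zero (h : Nat.Coprime 10 p) [NeZero (10 * p)] (hp : p.Prime) {s : Multiset (ZMod (10 * p))}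
    (hs : IsHodgeMultiset s) (hcard : Multiset.card s = 4) (hpf : ∀ a ∈ s, ∀ b ∈ s.erase a, a + b ≠ 0)
    (h0 : ∀ w ∈ s, (crt h w).2 = 0) : IsStd s := by
  classical
  have hp0 := hp.pos
  have hm : 10 * p = 10 * p := rfl
  have hnm : 10 ∣ 10 * p := ⟨p, rfl⟩
  obtain ⟨x₁, x₂, x₃, x₄, hsx⟩ := Multiset.card_eq_four.mp hcard
  have hx₁ : x₁ ∈ s := by rw [hsx]; simp
  have hx₂ : x₂ ∈ s := by rw [hsx]; simp
  have hx₃ : x₃ ∈ s := by rw [hsx]; simp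
  have hx₄ : x₄ ∈ s := by rw [hsx]; simp
  have hdiv : ∀ w ∈ s, p ∣ w.val := fun w hw ↦ (snd_eq_zero_iff h w).1 (h0 w hw)
  set L := liftBy (10 * p) 10 p with hL
  set k₁ : ZMod 10 := ((x₁.val / p : ℕ) : ZMod 10)
  set k₂ : ZMod 10 := ((x₂.val / p : ℕ) : ZMod 10)
  set k₃ : ZMod 10 := ((x₃.val / p : ℕ) : ZMod 10)
  set k₄ : ZMod 10 := ((x₄.val / p : ℕ) : ZMod 10)
  have e₁ : L k₁ = x₁ := liftBy_div hm hp0 (hdiv x₁ hx₁)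
  have e₂ : L k₂ = x₂ := liftBy_div hm hp0 (hdiv x₂ hx₂)
  have e₃ : L k₃ = x₃ := liftBy_div hm hp0 (hdiv x₃ hx₃)
  have e₄ : L k₄ = x₄ := liftBy_div hm hp0 (hdiv x₄ hx₄)
  have hsM : s = ({k₁, k₂, k₃, k₄} : Multiset (ZMod 10)).map L := by
    rw [hsx]; simp only [Multiset.insert_eq_cons, Multiset.map_cons, Multiset.map_singleton, e₁, e₂, e₃, e₄]
  have hM : IsHodgeMultiset ({k₁, k₂, k₃, k₄} : Multiset (ZMod 10)) :=
    (isHodgeMultiset_map_liftBy_iff hm hp0 _).1 (hsM ▸ hs)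
  -- `Σ = 0`
  have hk₄ : k₄ = -(k₁ + k₂ + k₃) := by
    have hsum := hM.1.2
    simp only [Multiset.insert_eq_cons, Multiset.sum_cons, Multiset.sum_singleton] at hsum
    linear_combination hsum
  have H : levHyp k₁ k₂ k₃ := by
    have hne := hM.1.1
    obtain ⟨p12, p13, p14, p23, p24, p34⟩ := six_pairs hsx hpf
    have P : ∀ {a b : ZMod 10} {x y : ZMod (10 * p)}, L a = x → L b = y → x + y ≠ 0 → a + b ≠ 0 := by
      rintro a b x y rfl rfl hxy e
      rw [← liftBy_add hm, e, liftBy_zero] at hxy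
      exact hxy rfl
    simp only [levHyp, ← hk₄]
    refine ⟨hne k₁ (by simp), hne k₂ (by simp), hne k₃ (by simp), hne k₄ (by simp), fun t ht ↦ ?_,
      P e₁ e₂ p12, P e₁ e₃ p13, P e₁ e₄ p14, P e₂ e₃ p23, P e₂ e₄ p24, P e₃ e₄ p34⟩
    have htU : IsUnit t := by
      simp only [unitB, Bool.or_eq_true, beq_iff_eq] at ht
      rcases ht with ((rfl | rfl) | rfl) | rfl <;> decide
    obtain ⟨τ, rfl⟩ := htU
    have key := hM.2 τ
    simp only [Multiset.insert_eq_cons, Multiset.map_cons, Multiset.map_singleton, Multiset.card_cons,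
      Multiset.card_singleton, mNormSum_cons, mNormSum_singleton] at key
    omega
  obtain ⟨x, hx⟩ := level_ten_forms k₁ k₂ k₃ H
  refine ⟨L x, ?_⟩
  have hK : L 5 = K10 := by
    simp only [hL, liftBy]
    rw [show (5 : ZMod 10).val = 5 from rfl]
  have ladd : ∀ y z : ZMod 10, L (y + z) = L y + L z := fun y z ↦ liftBy_add hm y z
  have l2 : ∀ y : ZMod 10, L (2 * y) = 2 * L y := fun y ↦ by rw [two_mul, two_mul, ladd]
  have l4 : ∀ y : ZMod 10, L (4 * y) = 4 * L y := fun y ↦ by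
    rw [show (4 : ZMod 10) * y = 2 * y + 2 * y by ring, ladd, l2]; ring
  have ln : ∀ y : ZMod 10, L (-y) = -L y := fun y ↦ by
    rw [eq_neg_iff_add_eq_zero, ← ladd, neg_add_cancel]; exact liftBy_zero
  rw [hk₄] at hsM
  rcases hx with hx | hx
  · left
    rw [hsM, hx]
    simp only [Multiset.insert_eq_cons, Multiset.map_cons, Multiset.map_singleton, ladd, hK, ln, l2]
  · right
    rw [hsM, hx]
    simp only [Multiset.insert_eq_cons, Multiset.map_cons, Multiset.map_singleton, ladd, hK, ln, l2, l4]

/-! ### Evaluating member contributions: the fibres `±c, ±2c, ±5c, ±10c` -/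

/-- For `c ≠ 0` (`p ≥ 19`) the eight fibres `±c, ±2c, ±5c, ±10c` are pairwise distinct. [folklore] -/
private theorem fib8 (hp : p.Prime) (h19 : 19 ≤ p) {c : ZMod p} (hc : c ≠ 0) :
    (-c ≠ c ∧ 2 * c ≠ c ∧ -(2 * c) ≠ c ∧ 5 * c ≠ c ∧ -(5 * c) ≠ c ∧ 10 * c ≠ c ∧ -(10 * c) ≠ c) ∧
    (2 * c ≠ -c ∧ -(2 * c) ≠ -c ∧ 5 * c ≠ -c ∧ -(5 * c) ≠ -c ∧ 10 * c ≠ -c ∧ -(10 * c) ≠ -c) ∧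
    (-(2 * c) ≠ 2 * c ∧ 5 * c ≠ 2 * c ∧ -(5 * c) ≠ 2 * c ∧ 10 * c ≠ 2 * c ∧ -(10 * c) ≠ 2 * c) ∧
    (5 * c ≠ -(2 * c) ∧ -(5 * c) ≠ -(2 * c) ∧ 10 * c ≠ -(2 * c) ∧ -(10 * c) ≠ -(2 * c)) ∧
    (-(5 * c) ≠ 5 * c ∧ 10 * c ≠ 5 * c ∧ -(10 * c) ≠ 5 * c) ∧
    (10 * c ≠ -(5 * c) ∧ -(10 * c) ≠ -(5 * c)) ∧
    (-(10 * c) ≠ 10 * c) := by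
  have K : ∀ i j : ℤ, ¬ p ∣ (i - j).natAbs → (i : ZMod p) * c ≠ (j : ZMod p) * c := fun i j hij ↦ kne hp hc hij
  have S : ∀ n : ℕ, 0 < n → n < 19 → ¬ p ∣ n := fun n h0 hn ↦ nd_small h19 h0 hn
  have S20 : ¬ p ∣ 20 := nd_mul hp (a := 4) (b := 5) (S 4 (by norm_num) (by norm_num)) (S 5 (by norm_num) (by norm_num))
  refine ⟨⟨?_, ?_, ?_, ?_, ?_, ?_, ?_⟩, ⟨?_, ?_, ?_, ?_, ?_, ?_⟩, ⟨?_, ?_, ?_, ?_, ?_⟩, ⟨?_, ?_, ?_, ?_⟩, ⟨?_, ?_, ?_⟩, ⟨?_, ?_⟩, ?_⟩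
  · intro e; exact K (-1) 1 (S _ (by norm_num) (by norm_num)) (by push_cast; linear_combination e)
  · intro e; exact K 2 1 (S _ (by norm_num) (by norm_num)) (by push_cast; linear_combination e)
  · intro e; exact K (-2) 1 (S _ (by norm_num) (by norm_num)) (by push_cast; linear_combination e)
  · intro e; exact K 5 1 (S _ (by norm_num) (by norm_num)) (by push_cast; linear_combination e)
  · intro e; exact K (-5) 1 (S _ (by norm_num) (by norm_num)) (by push_cast; linear_combination e)
  · intro e; exact K 10 1 (S _ (by norm_num) (by norm_num)) (by push_cast; linear_combination e)
  · intro e; exact K (-10) 1 (S _ (by norm_num) (by norm_num)) (by push_cast; linear_combination e)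
  · intro e; exact K 2 (-1) (S _ (by norm_num) (by norm_num)) (by push_cast; linear_combination e)
  · intro e; exact K (-2) (-1) (S _ (by norm_num) (by norm_num)) (by push_cast; linear_combination e)
  · intro e; exact K 5 (-1) (S _ (by norm_num) (by norm_num)) (by push_cast; linear_combination e)
  · intro e; exact K (-5) (-1) (S _ (by norm_num) (by norm_num)) (by push_cast; linear_combination e)
  · intro e; exact K 10 (-1) (S _ (by norm_num) (by norm_num)) (by push_cast; linear_combination e)
  · intro e; exact K (-10) (-1) (S _ (by norm_num) (by norm_num)) (by push_cast; linear_combination e)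
  · intro e; exact K (-2) 2 (S _ (by norm_num) (by norm_num)) (by push_cast; linear_combination e)
  · intro e; exact K 5 2 (S _ (by norm_num) (by norm_num)) (by push_cast; linear_combination e)
  · intro e; exact K (-5) 2 (S _ (by norm_num) (by norm_num)) (by push_cast; linear_combination e)
  · intro e; exact K 10 2 (S _ (by norm_num) (by norm_num)) (by push_cast; linear_combination e)
  · intro e; exact K (-10) 2 (S _ (by norm_num) (by norm_num)) (by push_cast; linear_combination e)
  · intro e; exact K 5 (-2) (S _ (by norm_num) (by norm_num)) (by push_cast; linear_combination e)
  · intro e; exact K (-5) (-2) (S _ (by norm_num) (by norm_num)) (by push_cast; linear_combination e)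
  · intro e; exact K 10 (-2) (S _ (by norm_num) (by norm_num)) (by push_cast; linear_combination e)
  · intro e; exact K (-10) (-2) (S _ (by norm_num) (by norm_num)) (by push_cast; linear_combination e)
  · intro e; exact K (-5) 5 (S _ (by norm_num) (by norm_num)) (by push_cast; linear_combination e)
  · intro e; exact K 10 5 (S _ (by norm_num) (by norm_num)) (by push_cast; linear_combination e)
  · intro e; exact K (-10) 5 (S _ (by norm_num) (by norm_num)) (by push_cast; linear_combination e)
  · intro e; exact K 10 (-5) (S _ (by norm_num) (by norm_num)) (by push_cast; linear_combination e)
  · intro e; exact K (-10) (-5) (S _ (by norm_num) (by norm_num)) (by push_cast; linear_combination e)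
  · intro e; exact K (-10) 10 (by rw [show ((-10 : ℤ) - 10).natAbs = 20 by norm_num]; exact S20) (by push_cast; linear_combination e)

/-- Evaluation of `contrib4` at the eight fibres. [folklore] -/
private theorem contrib4_at (hp : p.Prime) (h19 : 19 ≤ p) {c : ZMod p} (hc : c ≠ 0) (A B C D : ZMod 10 → ℤ) (e : ZMod 10) :
    contrib4 A B C D c e c = A e ∧ contrib4 A B C D c e (-c) = -A e ∧
    contrib4 A B C D c e (2 * c) = B e ∧ contrib4 A B C D c e (-(2 * c)) = -B e ∧
    contrib4 A B C D c e (5 * c) = C e ∧ contrib4 A B C D c e (-(5 * c)) = -C e ∧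
    contrib4 A B C D c e (10 * c) = D e ∧ contrib4 A B C D c e (-(10 * c)) = -D e := by
  obtain ⟨⟨a1, a2, a3, a4, a5, a6, a7⟩, ⟨b1, b2, b3, b4, b5, b6⟩, ⟨c1, c2, c3, c4, c5⟩, ⟨d1, d2, d3, d4⟩, ⟨e1, e2, e3⟩,
    ⟨f1, f2⟩, g1⟩ := fib8 hp h19 hc
  simp only [contrib4, if_true, if_neg a1, if_neg a2, if_neg a3, if_neg a4, if_neg a5, if_neg a6, if_neg a7,
    if_neg a1.symm, if_neg b1, if_neg b2, if_neg b3, if_neg b4, if_neg b5, if_neg b6,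
    if_neg a2.symm, if_neg b1.symm, if_neg c1, if_neg c2, if_neg c3, if_neg c4, if_neg c5,
    if_neg a3.symm, if_neg b2.symm, if_neg c1.symm, if_neg d1, if_neg d2, if_neg d3, if_neg d4,
    if_neg a4.symm, if_neg b3.symm, if_neg c2.symm, if_neg d1.symm, if_neg e1, if_neg e2, if_neg e3,
    if_neg a5.symm, if_neg b4.symm, if_neg c3.symm, if_neg d2.symm, if_neg e1.symm, if_neg f1, if_neg f2,
    if_neg a6.symm, if_neg b5.symm, if_neg c4.symm, if_neg d3.symm, if_neg e2.symm, if_neg f1.symm, if_neg g1,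
    if_neg a7.symm, if_neg b6.symm, if_neg c5.symm, if_neg d4.symm, if_neg e3.symm, if_neg f2.symm, if_neg g1.symm]
  refine ⟨by ring, by ring, by ring, by ring, by ring, by ring, by ring, by ring⟩

/-- Evaluation of `contrib2` and `contribO` at the four fibres `±c, ±2c`. [folklore] -/
private theorem contrib2_at (hp : p.Prime) (h19 : 19 ≤ p) {c : ZMod p} (hc : c ≠ 0) (A B : ZMod 10 → ℤ) (e : ZMod 10) :
    (contrib2 A B c e c = A e ∧ contrib2 A B c e (-c) = -A e ∧ contrib2 A B c e (2 * c) = B e ∧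
      contrib2 A B c e (-(2 * c)) = -B e) ∧
    (contribO A B c e c = A e ∧ contribO A B c e (-c) = A e ∧ contribO A B c e (2 * c) = B e ∧
      contribO A B c e (-(2 * c)) = B e) := by
  obtain ⟨⟨a1, a2, a3, -, -, -, -⟩, ⟨b1, b2, -, -, -, -⟩, ⟨c1, -, -, -, -⟩, -, -, -, -⟩ := fib8 hp h19 hc
  simp only [contrib2, contribO, if_true, if_neg a1, if_neg a2, if_neg a3, if_neg a1.symm, if_neg b1, if_neg b2,
    if_neg a2.symm, if_neg b1.symm, if_neg c1, if_neg a3.symm, if_neg b2.symm, if_neg c1.symm]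
  refine ⟨⟨by ring, by ring, by ring, by ring⟩, ⟨by ring, by ring, by ring, by ring⟩⟩

/-- A member off the eight fibres contributes nothing to `R¹`. [folklore] -/
private theorem contrib4_off {c d : ZMod p} (A B C D : ZMod 10 → ℤ) (e : ZMod 10) (h1 : d ≠ c) (h2 : d ≠ -c)
    (h3 : d ≠ 2 * c) (h4 : d ≠ -(2 * c)) (h5 : d ≠ 5 * c) (h6 : d ≠ -(5 * c)) (h7 : d ≠ 10 * c)
    (h8 : d ≠ -(10 * c)) : contrib4 A B C D c e d = 0 := by
  simp only [contrib4, if_neg (Ne.symm h1), if_neg (Ne.symm h2), if_neg (Ne.symm h3), if_neg (Ne.symm h4),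
    if_neg (Ne.symm h5), if_neg (Ne.symm h6), if_neg (Ne.symm h7), if_neg (Ne.symm h8)]
  ring

/-- A member off the fibres `±c, ±2c` contributes nothing to `R^χ`, `Γ`. [folklore] -/
private theorem contrib2_off {c d : ZMod p} (A B : ZMod 10 → ℤ) (e : ZMod 10) (h1 : d ≠ c) (h2 : d ≠ -c)
    (h3 : d ≠ 2 * c) (h4 : d ≠ -(2 * c)) : contrib2 A B c e d = 0 ∧ contribO A B c e d = 0 := by
  simp only [contrib2, contribO, if_neg (Ne.symm h1), if_neg (Ne.symm h2), if_neg (Ne.symm h3), if_neg (Ne.symm h4)]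
  exact ⟨by ring, by ring⟩

/-! ### Exactly two members off the fibre `0`: impossible -/

/-- The finite fact: no residues `u₁, u₂ mod 10` with `u₁ + u₂ ≠ 0` satisfy the six table identities forced by `Γ`, `R¹` on
`{(u₁, y), (u₂, −y)}`. [folklore] -/
private theorem fin_two_off : ∀ u₁ u₂ : ZMod 10, u₁ + u₂ ≠ 0 → tARe u₁ + tARe u₂ = 0 → tAIm u₁ + tAIm u₂ = 0 →
    tBRe u₁ + tBRe u₂ = 0 → tBIm u₁ + tBIm u₂ = 0 → tC1 u₁ - tC1 u₂ = 0 → tD1 u₁ - tD1 u₂ = 0 → False := by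
  decide

/-- **Two members off the fibre `0`, two in it: impossible.** [folklore] -/
private theorem two_off (hp : p.Prime) (h19 : 19 ≤ p) {u₁ u₂ u₃ u₄ : ZMod 10} {y : ZMod p} (hy : y ≠ 0)
    (h12 : u₁ + u₂ ≠ 0) (hR : Rels0 ({(u₁, y), (u₂, -y), (u₃, 0), (u₄, 0)} : Multiset (ZMod 10 × ZMod p))) : False := by
  haveI := Fact.mk hp
  obtain ⟨c2, hc2⟩ := exists_half hp h19 y
  obtain ⟨c5, hc5⟩ := exists_fifth hp h19 y
  obtain ⟨c10, hc10⟩ := exists_half hp h19 c5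
  have hc2' : c2 ≠ 0 := by rintro rfl; exact hy (by rw [hc2, mul_zero])
  have hc5' : c5 ≠ 0 := by rintro rfl; exact hy (by rw [hc5, mul_zero])
  have hc10' : c10 ≠ 0 := by rintro rfl; exact hc5' (by rw [hc10, mul_zero])
  have hy10 : y = 10 * c10 := by rw [hc5, hc10]; ring
  -- `Γ` at `y`
  have g1 := hR.gre y hy
  have g2 := hR.gim y hy
  rw [(cR_four _ _ _ _ _).2.2.1] at g1
  rw [(cR_four _ _ _ _ _).2.2.2] at g2
  simp only [(contrib2_at hp h19 hy _ _ _).2, (contrib_fibre_zero hp h19 hy _).2.2] at g1 g2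
  -- `Γ` at `y/2`
  have g3 := hR.gre c2 hc2'
  have g4 := hR.gim c2 hc2'
  rw [(cR_four _ _ _ _ _).2.2.1, hc2] at g3
  rw [(cR_four _ _ _ _ _).2.2.2, hc2] at g4
  simp only [(contrib2_at hp h19 hc2' _ _ _).2, (contrib_fibre_zero hp h19 hc2' _).2.2] at g3 g4
  -- `R¹` at `y/5` and `y/10`
  have r5 := hR.rel1 c5 hc5'
  rw [(cR_four _ _ _ _ _).1, hc5] at r5
  simp only [(contrib4_at hp h19 hc5' _ _ _ _ _), (contrib_fibre_zero hp h19 hc5' _).1] at r5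
  have r10 := hR.rel1 c10 hc10'
  rw [(cR_four _ _ _ _ _).1, hy10] at r10
  simp only [(contrib4_at hp h19 hc10' _ _ _ _ _), (contrib_fibre_zero hp h19 hc10' _).1] at r10
  exact fin_two_off u₁ u₂ h12 (by linarith) (by linarith) (by linarith) (by linarith) (by linarith) (by linarith)

/-! ### Case Z: all members `≡ 0 (mod 5)` — the level `2p` -/

/-- A pair-free multiset of values gives a pair-free function. [folklore] -/
private theorem fun_pairfree {n : ℕ} {α : Fin 4 → ZMod n} (hpf : ∀ a ∈ univ.val.map α, ∀ b ∈ (univ.val.map α).erase a, a + b ≠ 0)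
    (i j : Fin 4) (hij : i ≠ j) : α i + α j ≠ 0 := by
  classical
  intro e
  have hi : α i ∈ univ.val.map α := Multiset.mem_map_of_mem _ (Finset.mem_univ_val i)
  refine hpf (α i) hi (α j) ?_ e
  by_cases hji : α j = α i
  · rw [hji]
    have h2 : 2 ≤ Multiset.count (α i) (univ.val.map α) := by
      rw [count_univ_val_map]
      have : ({i, j} : Finset (Fin 4)) ⊆ univ.filter (fun k ↦ α k = α i) := by
        intro k hk
        simp only [Finset.mem_insert, Finset.mem_singleton] at hk
        rcases hk with rfl | rfl <;> simp [hji]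
      have := Finset.card_le_card this
      rwa [Finset.card_pair hij] at this
    rw [← Multiset.count_pos, Multiset.count_erase_self]; omega
  · exact (Multiset.mem_erase_of_ne hji).2 (Multiset.mem_map_of_mem _ (Finset.mem_univ_val j))

/-- Reindexing by a permutation does not change the multiset of values. [folklore] -/
private theorem univ_val_map_comp_perm {X : Type*} (α : Fin 4 → X) (σ : Equiv.Perm (Fin 4)) :
    univ.val.map (α ∘ σ) = univ.val.map α := by
  rw [← Multiset.map_map, Multiset.map_univ_val_equiv]

/-- **Case Z.** All members divisible by `5`: `s = 5·M` with `M` a pair-free Hodge quadruple of level `2p`, which by the tree's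
`exists_perm_std_twicePrime` is `α′_c` or `β′_c`; hence `s` is `α_{5c}` or `β_{5c}`. [cite: Shioda1982PicardFermat, Prop. 4 (Q′) p. 729]
[cite: MeyerNeutsch1981Fermatquadrupel, Satz 2 p. 56] -/
private theorem case_five [NeZero (10 * p)] (hp : p.Prime) (h19 : 19 ≤ p) {s : Multiset (ZMod (10 * p))}
    (hs : IsHodgeMultiset s) (hcard : Multiset.card s = 4) (hpf : ∀ a ∈ s, ∀ b ∈ s.erase a, a + b ≠ 0)
    (h5 : ∀ w ∈ s, 5 ∣ w.val) : IsStd s := by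
  classical
  have hp0 := hp.pos
  haveI : NeZero (2 * p) := ⟨by omega⟩
  have hm : 10 * p = 2 * p * 5 := by ring
  obtain ⟨M, hsM, hcM, hpfM⟩ := exists_eq_map_liftBy (m := 10 * p) (n := 2 * p) (d := 5) hm (by norm_num) h5
  have hM : IsHodgeMultiset M := (isHodgeMultiset_map_liftBy_iff hm (by norm_num) M).1 (hsM ▸ hs)
  have hpf' := hpfM hpf
  rw [hcard] at hcM
  obtain ⟨r, α, hα, hαM⟩ := hM.exists_isHodge
  have hr : r = 4 := by have := congrArg Multiset.card hαM; simp [hcM] at this; omega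
  subst hr
  have hind : ∀ i j : Fin 4, i ≠ j → α i + α j ≠ 0 := fun i j hij ↦ fun_pairfree (hαM ▸ hpf') i j hij
  obtain ⟨c, σ, -, -, hform⟩ := exists_perm_std_twicePrime (m := 2 * p) rfl hp (by omega) hα hind
  set L := liftBy (10 * p) (2 * p) 5 with hL
  have ladd : ∀ y z : ZMod (2 * p), L (y + z) = L y + L z := fun y z ↦ liftBy_add hm y z
  have l2 : ∀ y : ZMod (2 * p), L (2 * y) = 2 * L y := fun y ↦ by
    rw [show (2 : ZMod (2 * p)) * y = y + y from two_mul y, ladd]; exact (two_mul _).symm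
  have l4 : ∀ y : ZMod (2 * p), L (4 * y) = 4 * L y := fun y ↦ by
    rw [show (4 : ZMod (2 * p)) * y = 2 * y + 2 * y by ring, ladd, l2]; ring
  have ln : ∀ y : ZMod (2 * p), L (-y) = -L y := fun y ↦ by
    rw [eq_neg_iff_add_eq_zero, ← ladd, neg_add_cancel]; exact liftBy_zero
  have hK : L ((p : ℕ) : ZMod (2 * p)) = K10 := by
    simp only [hL, liftBy, ZMod.val_natCast, Nat.mod_eq_of_lt (show p < 2 * p by omega), Nat.mul_comm p 5]
  have hMα : M = univ.val.map (α ∘ σ) := by rw [univ_val_map_comp_perm, hαM]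
  refine ⟨L c, ?_⟩
  rcases hform with hf | hf
  · have e : α ∘ σ = alphaStdTwicePrime p c := funext hf
    rw [e, univ_val_map_alphaStdTwicePrime] at hMα
    left
    rw [hsM, hMα]
    simp only [Multiset.insert_eq_cons, Multiset.map_cons, Multiset.map_singleton, ladd, hK, ln, l2]
  · have e : α ∘ σ = betaStdTwicePrime p c := funext hf
    rw [e, univ_val_map_betaStdTwicePrime] at hMα
    right
    rw [hsM, hMα]
    simp only [Multiset.insert_eq_cons, Multiset.map_cons, Multiset.map_singleton, ladd, hK, ln, l2, l4]

/-! ### Case U: the kernel enumeration over the relative positions `{±½, ±1, ±2}` -/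

/-- The tokens of case U, first chunk (see `tokU`). [folklore] -/
private def tokU₁ : List (Option (ZMod 10 × ℤ)) :=
  [none, some (1, 1), some (1, -1), some (1, 2), some (1, -2), some (3, 1), some (3, -1), some (3, 2), some (3, -2),
    some (7, 1), some (7, -1)]
/-- Second chunk. [folklore] -/
private def tokU₂ : List (Option (ZMod 10 × ℤ)) :=
  [some (7, 2), some (7, -2), some (9, 1), some (9, -1), some (9, 2), some (9, -2), some (2, 2), some (2, -2), some
    (2, 4), some (2, -4), some (4, 2)]
/-- Third chunk. [folklore] -/
private def tokU₃ : List (Option (ZMod 10 × ℤ)) :=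
  [some (4, -2), some (4, 4), some (4, -4), some (6, 2), some (6, -2), some (6, 4), some (6, -4), some (8, 2), some
    (8, -2), some (8, 4), some (8, -4)]

/-- A token: `none` (a member invisible to `Γ`, `R^χ` at the parameters `h = d₁/2` and `2h = d₁`), or `(w, λ)`: a member
`(w, λ·h)`; unit types `w` at `λ ∈ {±1, ±2}` (a unit type at `±4h` is excluded by the choice of `q₁`), even types at
`λ ∈ {±2, ±4}`. [folklore] -/
private def tokU : List (Option (ZMod 10 × ℤ)) := tokU₁ ++ tokU₂ ++ tokU₃

/-- Membership in `tokU` by chunks. [folklore] -/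
private theorem mem_tokU_iff (t : Option (ZMod 10 × ℤ)) : t ∈ tokU ↔ t ∈ tokU₁ ∨ t ∈ tokU₂ ∨ t ∈ tokU₃ := by
  rw [tokU, List.mem_append, List.mem_append, or_assoc]

/-- The tokens of case E (no unit-type member off the fibre `0`). [folklore] -/
private def tokE : List (Option (ZMod 10 × ℤ)) :=
  [none, some (2, 2), some (2, -2), some (2, 4), some (2, -4), some (4, 2), some (4, -2), some (4, 4), some (4, -4),
    some (6, 2), some (6, -2), some (6, 4), some (6, -4), some (8, 2), some (8, -2), some (8, 4), some (8, -4)]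

/-- Contribution of a token to an even-type relation at the parameter `μh`. [folklore] -/
private def evO (A B : ZMod 10 → ℤ) (μ : ℤ) : Option (ZMod 10 × ℤ) → ℤ
  | none => 0
  | some (w, l) => A w * (if l = μ ∨ l = -μ then 1 else 0) + B w * (if l = 2 * μ ∨ l = -(2 * μ) then 1 else 0)

/-- Contribution of a token to an odd-type relation at the parameter `μh`. [folklore] -/
private def ev2 (A B : ZMod 10 → ℤ) (μ : ℤ) : Option (ZMod 10 × ℤ) → ℤ
  | none => 0
  | some (w, l) => A w * ((if l = μ then 1 else 0) - (if l = -μ then 1 else 0)) +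
      B w * ((if l = 2 * μ then 1 else 0) - (if l = -(2 * μ) then 1 else 0))

/-- Sum of a token functional over four tokens. [folklore] -/
private def sum4 (f : Option (ZMod 10 × ℤ) → ℤ) (t₁ t₂ t₃ t₄ : Option (ZMod 10 × ℤ)) : ℤ := f t₁ + f t₂ + f t₃ + f t₄

/-- Two tokens forming a pair `{a, −a}`. [folklore] -/
private def tokPair : Option (ZMod 10 × ℤ) → Option (ZMod 10 × ℤ) → Bool
  | some (w, l), some (w', l') => decide (w + w' = 0 ∧ l + l' = 0)
  | _, _ => false

/-- Seen from `q₁ = (u₁, 2h)`: the six relation values (`Γ`, `R^χ` at `h` and `2h`) vanish. [folklore] -/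
private def hypRel (u₁ : ZMod 10) (t₂ t₃ t₄ : Option (ZMod 10 × ℤ)) : Bool :=
  decide (sum4 (evO tARe tBRe 1) (some (u₁, 2)) t₂ t₃ t₄ = 0) && decide (sum4 (evO tAIm tBIm 1) (some (u₁, 2)) t₂ t₃ t₄ = 0) &&
  decide (sum4 (ev2 tAchi tBchi 1) (some (u₁, 2)) t₂ t₃ t₄ = 0) && decide (sum4 (evO tARe tBRe 2) (some (u₁, 2)) t₂ t₃ t₄ = 0) &&
  decide (sum4 (evO tAIm tBIm 2) (some (u₁, 2)) t₂ t₃ t₄ = 0) && decide (sum4 (ev2 tAchi tBchi 2) (some (u₁, 2)) t₂ t₃ t₄ = 0)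

/-- Seen from `q₁ = (u₁, 2h)`: no two tokens are opposite. [folklore] -/
private def hypPair (u₁ : ZMod 10) (t₂ t₃ t₄ : Option (ZMod 10 × ℤ)) : Bool :=
  !(tokPair (some (u₁, 2)) t₂ || tokPair (some (u₁, 2)) t₃ || tokPair (some (u₁, 2)) t₄ || tokPair t₂ t₃ || tokPair t₂ t₄ ||
    tokPair t₃ t₄)

/-- Seen from `q₁ = (u₁, 2h)`: when all members are visible the coordinate sums vanish. [folklore] -/
private def hypSum (u₁ : ZMod 10) (t₂ t₃ t₄ : Option (ZMod 10 × ℤ)) : Bool :=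
  match t₂, t₃, t₄ with
  | some (w₂, l₂), some (w₃, l₃), some (w₄, l₄) => decide (u₁ + w₂ + w₃ + w₄ = 0 ∧ 2 + l₂ + l₃ + l₄ = 0)
  | _, _, _ => true

/-- The hypotheses on a token triple seen from `q₁ = (u₁, 2h)`. [folklore] -/
private def hypTok (u₁ : ZMod 10) (t₂ t₃ t₄ : Option (ZMod 10 × ℤ)) : Bool :=
  hypRel u₁ t₂ t₃ t₄ && hypPair u₁ t₂ t₃ t₄ && hypSum u₁ t₂ t₃ t₄

/-- The `α`-pattern seen from `x = (u₁, 2h)`: `(u₁+5, 2h)`, `(−2u₁, −4h)`, one invisible member. [folklore] -/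
private def patA (u₁ : ZMod 10) (a b c : Option (ZMod 10 × ℤ)) : Prop :=
  a = some (u₁ + 5, 2) ∧ b = some (-(2 * u₁), -4) ∧ c = none

/-- The `β`-pattern seen from its member `2x + 5p = (u₁, 2h)`: `x = (v, h)` with `2v = u₁ + 5`, `v` of unit type,
`−4x = (−2u₁, −4h)`, and one invisible member (`x + 5p`). [folklore] -/
private def patB (u₁ : ZMod 10) (a b c : Option (ZMod 10 × ℤ)) : Prop :=
  (∃ v : ZMod 10, tU v = 1 ∧ 2 * v = u₁ + 5 ∧ a = some (v, 1)) ∧ b = some (-(2 * u₁), -4) ∧ c = none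

/-- `patA` is decidable. [folklore] -/
private instance (u₁ : ZMod 10) (a b c : Option (ZMod 10 × ℤ)) : Decidable (patA u₁ a b c) := by
  unfold patA; infer_instance
/-- `patB` is decidable. [folklore] -/
private instance (u₁ : ZMod 10) (a b c : Option (ZMod 10 × ℤ)) : Decidable (patB u₁ a b c) := by
  unfold patB; infer_instance

/-- The conclusion: up to order, the triple is the `α`- or the `β`-pattern. [folklore] -/
private def conclTok (u₁ : ZMod 10) (t₂ t₃ t₄ : Option (ZMod 10 × ℤ)) : Prop :=
  (patA u₁ t₂ t₃ t₄ ∨ patB u₁ t₂ t₃ t₄) ∨ (patA u₁ t₂ t₄ t₃ ∨ patB u₁ t₂ t₄ t₃) ∨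
  (patA u₁ t₃ t₂ t₄ ∨ patB u₁ t₃ t₂ t₄) ∨ (patA u₁ t₃ t₄ t₂ ∨ patB u₁ t₃ t₄ t₂) ∨
  (patA u₁ t₄ t₂ t₃ ∨ patB u₁ t₄ t₂ t₃) ∨ (patA u₁ t₄ t₃ t₂ ∨ patB u₁ t₄ t₃ t₂)

/-- `conclTok` is decidable. [folklore] -/
private instance (u₁ : ZMod 10) (t₂ t₃ t₄ : Option (ZMod 10 × ℤ)) : Decidable (conclTok u₁ t₂ t₃ t₄) := by
  unfold conclTok; infer_instance

/-- The Boolean test of case U at one token triple. [folklore] -/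
private def testU (u₁ : ZMod 10) (t₂ t₃ t₄ : Option (ZMod 10 × ℤ)) : Bool :=
  !hypTok u₁ t₂ t₃ t₄ || decide (conclTok u₁ t₂ t₃ t₄)

/-- The Boolean test of case U over a chunk of first tokens, for one `u₁`. [folklore] -/
private def checkU (u₁ : ZMod 10) (C : List (Option (ZMod 10 × ℤ))) : Bool :=
  C.all fun t₂ ↦ tokU.all fun t₃ ↦ tokU.all fun t₄ ↦ testU u₁ t₂ t₃ t₄

set_option maxHeartbeats 0 in
/-- Kernel enumeration of case U: `u₁ = 1`, chunk 1. [folklore] -/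
private theorem checkU_one_1 : checkU 1 tokU₁ = true := by decide +kernel

set_option maxHeartbeats 0 in
/-- Kernel enumeration of case U: `u₁ = 1`, chunk 2. [folklore] -/
private theorem checkU_one_2 : checkU 1 tokU₂ = true := by decide +kernel

set_option maxHeartbeats 0 in
/-- Kernel enumeration of case U: `u₁ = 1`, chunk 3. [folklore] -/
private theorem checkU_one_3 : checkU 1 tokU₃ = true := by decide +kernel

set_option maxHeartbeats 0 in
/-- Kernel enumeration of case U: `u₁ = 3`, chunk 1. [folklore] -/
private theorem checkU_three_1 : checkU 3 tokU₁ = true := by decide +kernel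

set_option maxHeartbeats 0 in
/-- Kernel enumeration of case U: `u₁ = 3`, chunk 2. [folklore] -/
private theorem checkU_three_2 : checkU 3 tokU₂ = true := by decide +kernel

set_option maxHeartbeats 0 in
/-- Kernel enumeration of case U: `u₁ = 3`, chunk 3. [folklore] -/
private theorem checkU_three_3 : checkU 3 tokU₃ = true := by decide +kernel

set_option maxHeartbeats 0 in
/-- Kernel enumeration of case U: `u₁ = 7`, chunk 1. [folklore] -/
private theorem checkU_seven_1 : checkU 7 tokU₁ = true := by decide +kernel

set_option maxHeartbeats 0 in
/-- Kernel enumeration of case U: `u₁ = 7`, chunk 2. [folklore] -/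
private theorem checkU_seven_2 : checkU 7 tokU₂ = true := by decide +kernel

set_option maxHeartbeats 0 in
/-- Kernel enumeration of case U: `u₁ = 7`, chunk 3. [folklore] -/
private theorem checkU_seven_3 : checkU 7 tokU₃ = true := by decide +kernel

set_option maxHeartbeats 0 in
/-- Kernel enumeration of case U: `u₁ = 9`, chunk 1. [folklore] -/
private theorem checkU_nine_1 : checkU 9 tokU₁ = true := by decide +kernel

set_option maxHeartbeats 0 in
/-- Kernel enumeration of case U: `u₁ = 9`, chunk 2. [folklore] -/
private theorem checkU_nine_2 : checkU 9 tokU₂ = true := by decide +kernel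

set_option maxHeartbeats 0 in
/-- Kernel enumeration of case U: `u₁ = 9`, chunk 3. [folklore] -/
private theorem checkU_nine_3 : checkU 9 tokU₃ = true := by decide +kernel

/-- `checkU u₁` on the whole of `tokU` from the chunks. [folklore] -/
private theorem checkU_of_chunks {u₁ : ZMod 10} (h₁ : checkU u₁ tokU₁ = true) (h₂ : checkU u₁ tokU₂ = true)
    (h₃ : checkU u₁ tokU₃ = true) : ∀ t₂ ∈ tokU, (tokU.all fun t₃ ↦ tokU.all fun t₄ ↦ testU u₁ t₂ t₃ t₄) = true := by
  intro t₂ ht₂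
  unfold checkU at h₁ h₂ h₃
  rcases (mem_tokU_iff t₂).1 ht₂ with h | h | h
  · exact List.all_eq_true.mp h₁ t₂ h
  · exact List.all_eq_true.mp h₂ t₂ h
  · exact List.all_eq_true.mp h₃ t₂ h

/-- **Case U, finite form**: seen from a unit-type member with no unit-type member over `±4h = ±2d₁`, the visible members form
the `α`- or the `β`-pattern. [folklore] -/
private theorem enumU {u₁ : ZMod 10} (hu : tU u₁ = 1) {t₂ t₃ t₄ : Option (ZMod 10 × ℤ)} (h₂ : t₂ ∈ tokU) (h₃ : t₃ ∈ tokU)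
    (h₄ : t₄ ∈ tokU) (hh : hypTok u₁ t₂ t₃ t₄ = true) : conclTok u₁ t₂ t₃ t₄ := by
  have key : ∀ t₂ ∈ tokU, (tokU.all fun t₃ ↦ tokU.all fun t₄ ↦ testU u₁ t₂ t₃ t₄) = true := by
    rcases tU_cases u₁ hu with rfl | rfl | rfl | rfl
    · exact checkU_of_chunks checkU_one_1 checkU_one_2 checkU_one_3
    · exact checkU_of_chunks checkU_three_1 checkU_three_2 checkU_three_3
    · exact checkU_of_chunks checkU_seven_1 checkU_seven_2 checkU_seven_3
    · exact checkU_of_chunks checkU_nine_1 checkU_nine_2 checkU_nine_3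
  have k1 := key t₂ h₂
  have k2 := List.all_eq_true.mp k1 t₃ h₃
  have k3 := List.all_eq_true.mp k2 t₄ h₄
  unfold testU at k3
  rw [hh, Bool.not_true, Bool.false_or] at k3
  exact of_decide_eq_true k3

/-- The Boolean test of case E over all token triples, for one `e₁`. [folklore] -/
private def checkE (e₁ : ZMod 10) : Bool :=
  tokE.all fun t₂ ↦ tokE.all fun t₃ ↦ tokE.all fun t₄ ↦ !hypTok e₁ t₂ t₃ t₄

set_option maxHeartbeats 0 in
/-- Kernel enumeration of case E, `e₁ = 2`. [folklore] -/
private theorem checkE_two : checkE 2 = true := by decide +kernel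

set_option maxHeartbeats 0 in
/-- Kernel enumeration of case E, `e₁ = 4`. [folklore] -/
private theorem checkE_four : checkE 4 = true := by decide +kernel

set_option maxHeartbeats 0 in
/-- Kernel enumeration of case E, `e₁ = 6`. [folklore] -/
private theorem checkE_six : checkE 6 = true := by decide +kernel

set_option maxHeartbeats 0 in
/-- Kernel enumeration of case E, `e₁ = 8`. [folklore] -/
private theorem checkE_eight : checkE 8 = true := by decide +kernel

/-- **Case E, finite form**: an even-type member off the fibre `0` without unit-type members off it is impossible. [folklore] -/
private theorem enumE {e₁ : ZMod 10} (he : tE e₁ = 1) {t₂ t₃ t₄ : Option (ZMod 10 × ℤ)} (h₂ : t₂ ∈ tokE) (h₃ : t₃ ∈ tokE)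
    (h₄ : t₄ ∈ tokE) (hh : hypTok e₁ t₂ t₃ t₄ = true) : False := by
  have k : checkE e₁ = true := by
    rcases tE_cases e₁ he with rfl | rfl | rfl | rfl
    exacts [checkE_two, checkE_four, checkE_six, checkE_eight]
  unfold checkE at k
  have k1 := List.all_eq_true.mp k t₂ h₂
  have k2' := List.all_eq_true.mp k1 t₃ h₃
  have k3 := List.all_eq_true.mp k2' t₄ h₄
  rw [hh] at k3
  simp at k3

/-! ### Case U: from members to tokens -/

/-- The tables `A` of `Γ`, `R^χ` vanish on the even type; all six tables vanish off `U ∪ E`. [folklore] -/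
private theorem tables_vanish : (∀ w : ZMod 10, tE w = 1 → tARe w = 0 ∧ tAIm w = 0 ∧ tAchi w = 0) ∧
    (∀ w : ZMod 10, tU w ≠ 1 → tE w ≠ 1 →
      tARe w = 0 ∧ tAIm w = 0 ∧ tAchi w = 0 ∧ tBRe w = 0 ∧ tBIm w = 0 ∧ tBchi w = 0) := by
  constructor <;> decide

/-- For `h ≠ 0` (`p ≥ 19`) the six fibres `±h, ±2h, ±4h` are pairwise distinct and non-zero multiples behave. [folklore] -/
private theorem fib6 (hp : p.Prime) (h19 : 19 ≤ p) {h : ZMod p} (hh : h ≠ 0) :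
    (-h ≠ h ∧ 2 * h ≠ h ∧ -(2 * h) ≠ h ∧ 4 * h ≠ h ∧ -(4 * h) ≠ h) ∧
    (2 * h ≠ -h ∧ -(2 * h) ≠ -h ∧ 4 * h ≠ -h ∧ -(4 * h) ≠ -h) ∧
    (-(2 * h) ≠ 2 * h ∧ 4 * h ≠ 2 * h ∧ -(4 * h) ≠ 2 * h) ∧
    (4 * h ≠ -(2 * h) ∧ -(4 * h) ≠ -(2 * h)) ∧ (-(4 * h) ≠ 4 * h) ∧ (2 * h ≠ 0 ∧ 4 * h ≠ 0) := by
  have K : ∀ i j : ℤ, ¬ p ∣ (i - j).natAbs → (i : ZMod p) * h ≠ (j : ZMod p) * h := fun i j hij ↦ kne hp hh hij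
  have S : ∀ n : ℕ, 0 < n → n < 19 → ¬ p ∣ n := fun n h0 hn ↦ nd_small h19 h0 hn
  refine ⟨⟨?_, ?_, ?_, ?_, ?_⟩, ⟨?_, ?_, ?_, ?_⟩, ⟨?_, ?_, ?_⟩, ⟨?_, ?_⟩, ?_, ⟨?_, ?_⟩⟩
  · intro e; exact K (-1) 1 (S _ (by norm_num) (by norm_num)) (by push_cast; linear_combination e)
  · intro e; exact K 2 1 (S _ (by norm_num) (by norm_num)) (by push_cast; linear_combination e)
  · intro e; exact K (-2) 1 (S _ (by norm_num) (by norm_num)) (by push_cast; linear_combination e)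
  · intro e; exact K 4 1 (S _ (by norm_num) (by norm_num)) (by push_cast; linear_combination e)
  · intro e; exact K (-4) 1 (S _ (by norm_num) (by norm_num)) (by push_cast; linear_combination e)
  · intro e; exact K 2 (-1) (S _ (by norm_num) (by norm_num)) (by push_cast; linear_combination e)
  · intro e; exact K (-2) (-1) (S _ (by norm_num) (by norm_num)) (by push_cast; linear_combination e)
  · intro e; exact K 4 (-1) (S _ (by norm_num) (by norm_num)) (by push_cast; linear_combination e)
  · intro e; exact K (-4) (-1) (S _ (by norm_num) (by norm_num)) (by push_cast; linear_combination e)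
  · intro e; exact K (-2) 2 (S _ (by norm_num) (by norm_num)) (by push_cast; linear_combination e)
  · intro e; exact K 4 2 (S _ (by norm_num) (by norm_num)) (by push_cast; linear_combination e)
  · intro e; exact K (-4) 2 (S _ (by norm_num) (by norm_num)) (by push_cast; linear_combination e)
  · intro e; exact K 4 (-2) (S _ (by norm_num) (by norm_num)) (by push_cast; linear_combination e)
  · intro e; exact K (-4) (-2) (S _ (by norm_num) (by norm_num)) (by push_cast; linear_combination e)
  · intro e; exact K (-4) 4 (S _ (by norm_num) (by norm_num)) (by push_cast; linear_combination e)
  · exact_mod_cast kne0 hp hh (k := 2) (S 2 (by norm_num) (by norm_num))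
  · exact_mod_cast kne0 hp hh (k := 4) (S 4 (by norm_num) (by norm_num))

/-- The position class of `d` relative to `h`: `λ ∈ {±1, ±2, ±4}` with `d = λh`, or `0`. [folklore] -/
private def cls (h d : ZMod p) : ℤ :=
  if d = h then 1 else if d = -h then -1 else if d = 2 * h then 2 else if d = -(2 * h) then -2
  else if d = 4 * h then 4 else if d = -(4 * h) then -4 else 0

/-- The token of a member `(w, d)` relative to `h`. [folklore] -/
private def tokOf (h : ZMod p) (w : ZMod 10) (d : ZMod p) : Option (ZMod 10 × ℤ) :=
  if (tU w = 1 ∧ (cls h d = 1 ∨ cls h d = -1 ∨ cls h d = 2 ∨ cls h d = -2)) ∨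
      (tE w = 1 ∧ (cls h d = 2 ∨ cls h d = -2 ∨ cls h d = 4 ∨ cls h d = -4)) then some (w, cls h d) else none

/-- The cases of `cls`. [folklore] -/
private theorem cls_cases (h d : ZMod p) :
    (cls h d = 1 ∧ d = h) ∨ (cls h d = -1 ∧ d = -h) ∨ (cls h d = 2 ∧ d = 2 * h) ∨ (cls h d = -2 ∧ d = -(2 * h)) ∨
      (cls h d = 4 ∧ d = 4 * h) ∨ (cls h d = -4 ∧ d = -(4 * h)) ∨
      (cls h d = 0 ∧ d ≠ h ∧ d ≠ -h ∧ d ≠ 2 * h ∧ d ≠ -(2 * h) ∧ d ≠ 4 * h ∧ d ≠ -(4 * h)) := by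
  unfold cls
  split_ifs with h1 h2 h3 h4 h5 h6
  · exact Or.inl ⟨rfl, h1⟩
  · exact Or.inr (Or.inl ⟨rfl, h2⟩)
  · exact Or.inr (Or.inr (Or.inl ⟨rfl, h3⟩))
  · exact Or.inr (Or.inr (Or.inr (Or.inl ⟨rfl, h4⟩)))
  · exact Or.inr (Or.inr (Or.inr (Or.inr (Or.inl ⟨rfl, h5⟩))))
  · exact Or.inr (Or.inr (Or.inr (Or.inr (Or.inr (Or.inl ⟨rfl, h6⟩)))))
  · exact Or.inr (Or.inr (Or.inr (Or.inr (Or.inr (Or.inr ⟨rfl, h1, h2, h3, h4, h5, h6⟩)))))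

/-- A visible token records the residue and the position: `d = λ·h`. [folklore] -/
private theorem tok_some {h : ZMod p} {w w' : ZMod 10} {d : ZMod p} {l : ℤ}
    (ht : tokOf h w d = some (w', l)) : w' = w ∧ d = (l : ZMod p) * h ∧ (tU w = 1 ∨ tE w = 1) := by
  unfold tokOf at ht
  split_ifs at ht with hv
  simp only [Option.some.injEq, Prod.mk.injEq] at ht
  obtain ⟨rfl, rfl⟩ := ht
  refine ⟨rfl, ?_, ?_⟩
  · rcases cls_cases h d with ⟨e, hd⟩ | ⟨e, hd⟩ | ⟨e, hd⟩ | ⟨e, hd⟩ | ⟨e, hd⟩ | ⟨e, hd⟩ | ⟨e, -⟩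
    all_goals rw [e]
    · rw [hd]; push_cast; ring
    · rw [hd]; push_cast; ring
    · rw [hd]; push_cast; ring
    · rw [hd]; push_cast; ring
    · rw [hd]; push_cast; ring
    · rw [hd]; push_cast; ring
    · exfalso; rw [e] at hv; rcases hv with ⟨-, hv⟩ | ⟨-, hv⟩ <;> norm_num at hv
  · rcases hv with ⟨hv, -⟩ | ⟨hv, -⟩
    · exact Or.inl hv
    · exact Or.inr hv

/-- Every token lies in the list `tokU`, provided unit types avoid `±4h`. [folklore] -/
private theorem tok_mem {h : ZMod p} (w : ZMod 10) (d : ZMod p) (htop : tU w = 1 → cls h d ≠ 4 ∧ cls h d ≠ -4) :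
    tokOf h w d ∈ tokU := by
  unfold tokOf
  split_ifs with hv
  · rcases hv with ⟨hw, hc⟩ | ⟨hw, hc⟩
    · rcases tU_cases w hw with rfl | rfl | rfl | rfl <;> rcases hc with hc | hc | hc | hc <;> rw [hc] <;> decide
    · rcases tE_cases w hw with rfl | rfl | rfl | rfl <;> rcases hc with hc | hc | hc | hc <;> rw [hc] <;> decide
  · decide

/-- **Contributions are read off the token.** For a member `(w, d)` (unit types off `±4h`) the contributions to `Γ`, `R^χ`
at the parameters `h` and `2h` are the token values `evO/ev2` at `μ = 1, 2`. [folklore] -/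
private theorem tok_contrib (hp : p.Prime) (h19 : 19 ≤ p) {h : ZMod p} (hh : h ≠ 0) (w : ZMod 10) (d : ZMod p)
    (htop : tU w = 1 → cls h d ≠ 4 ∧ cls h d ≠ -4) :
    contribO tARe tBRe h w d = evO tARe tBRe 1 (tokOf h w d) ∧ contribO tAIm tBIm h w d = evO tAIm tBIm 1 (tokOf h w d) ∧
    contrib2 tAchi tBchi h w d = ev2 tAchi tBchi 1 (tokOf h w d) ∧
    contribO tARe tBRe (2 * h) w d = evO tARe tBRe 2 (tokOf h w d) ∧
    contribO tAIm tBIm (2 * h) w d = evO tAIm tBIm 2 (tokOf h w d) ∧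
    contrib2 tAchi tBchi (2 * h) w d = ev2 tAchi tBchi 2 (tokOf h w d) := by
  obtain ⟨⟨a1, a2, a3, a4, a5⟩, ⟨b1, b2, b3, b4⟩, ⟨c1, c2, c3⟩, ⟨d1, d2⟩, e1, f2, f4⟩ := fib6 hp h19 hh
  have h2h : -(2 * (2 * h)) = -(4 * h) := by ring
  have h2h' : (2 : ZMod p) * (2 * h) = 4 * h := by ring
  obtain ⟨tvE, tv0⟩ := tables_vanish
  -- evaluate the left-hand sides through the class of `d`
  rcases cls_cases h d with ⟨e, hd⟩ | ⟨e, hd⟩ | ⟨e, hd⟩ | ⟨e, hd⟩ | ⟨e, hd⟩ | ⟨e, hd⟩ | ⟨e, n1, n2, n3, n4, n5, n6⟩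
  all_goals simp only [tokOf, e]
  · -- `d = h`
    subst hd
    have offRe := contrib2_off (c := 2 * d) (d := d) tARe tBRe w a2.symm a3.symm
      (by rw [h2h']; exact a4.symm) (by rw [h2h]; exact a5.symm)
    have offIm := contrib2_off (c := 2 * d) (d := d) tAIm tBIm w a2.symm a3.symm
      (by rw [h2h']; exact a4.symm) (by rw [h2h]; exact a5.symm)
    have offChi := contrib2_off (c := 2 * d) (d := d) tAchi tBchi w a2.symm a3.symm
      (by rw [h2h']; exact a4.symm) (by rw [h2h]; exact a5.symm)
    rw [(contrib2_at hp h19 hh tARe tBRe w).2.1, (contrib2_at hp h19 hh tAIm tBIm w).2.1,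
      (contrib2_at hp h19 hh tAchi tBchi w).1.1, offRe.2, offIm.2, offChi.1]
    by_cases hU : tU w = 1
    · simp [hU, evO, ev2]
    by_cases hE : tE w = 1
    · obtain ⟨z1, z2, z3⟩ := tvE w hE
      simp [hU, hE, evO, ev2, z1, z2, z3]
    · obtain ⟨z1, z2, z3, -, -, -⟩ := tv0 w hU hE
      simp [hU, hE, evO, ev2, z1, z2, z3]
  · -- `d = -h`
    subst hd
    have ne1 : -h ≠ 2 * h := fun e' ↦ b1 e'.symm
    have ne2 : -h ≠ -(2 * h) := fun e' ↦ b2 e'.symm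
    have ne3 : -h ≠ 2 * (2 * h) := by rw [h2h']; exact fun e' ↦ b3 e'.symm
    have ne4 : -h ≠ -(2 * (2 * h)) := by rw [h2h]; exact fun e' ↦ b4 e'.symm
    have offRe := contrib2_off (c := 2 * h) (d := -h) tARe tBRe w ne1 ne2 ne3 ne4
    have offIm := contrib2_off (c := 2 * h) (d := -h) tAIm tBIm w ne1 ne2 ne3 ne4
    have offChi := contrib2_off (c := 2 * h) (d := -h) tAchi tBchi w ne1 ne2 ne3 ne4
    rw [(contrib2_at hp h19 hh tARe tBRe w).2.2.1, (contrib2_at hp h19 hh tAIm tBIm w).2.2.1,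
      (contrib2_at hp h19 hh tAchi tBchi w).1.2.1, offRe.2, offIm.2, offChi.1]
    by_cases hU : tU w = 1
    · simp [hU, evO, ev2]
    by_cases hE : tE w = 1
    · obtain ⟨z1, z2, z3⟩ := tvE w hE
      simp [hU, hE, evO, ev2, z1, z2, z3]
    · obtain ⟨z1, z2, z3, -, -, -⟩ := tv0 w hU hE
      simp [hU, hE, evO, ev2, z1, z2, z3]
  · -- `d = 2h`
    subst hd
    rw [(contrib2_at hp h19 hh tARe tBRe w).2.2.2.1, (contrib2_at hp h19 hh tAIm tBIm w).2.2.2.1,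
      (contrib2_at hp h19 hh tAchi tBchi w).1.2.2.1, (contrib2_at hp h19 f2 tARe tBRe w).2.1,
      (contrib2_at hp h19 f2 tAIm tBIm w).2.1, (contrib2_at hp h19 f2 tAchi tBchi w).1.1]
    by_cases hU : tU w = 1
    · simp [hU, evO, ev2]
    by_cases hE : tE w = 1
    · obtain ⟨z1, z2, z3⟩ := tvE w hE
      simp [hU, hE, evO, ev2, z1, z2, z3]
    · obtain ⟨z1, z2, z3, z4, z5, z6⟩ := tv0 w hU hE
      simp [hU, hE, evO, ev2, z1, z2, z3, z4, z5, z6]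
  · -- `d = -2h`
    subst hd
    rw [(contrib2_at hp h19 hh tARe tBRe w).2.2.2.2, (contrib2_at hp h19 hh tAIm tBIm w).2.2.2.2,
      (contrib2_at hp h19 hh tAchi tBchi w).1.2.2.2, (contrib2_at hp h19 f2 tARe tBRe w).2.2.1,
      (contrib2_at hp h19 f2 tAIm tBIm w).2.2.1, (contrib2_at hp h19 f2 tAchi tBchi w).1.2.1]
    by_cases hU : tU w = 1
    · simp [hU, evO, ev2]
    by_cases hE : tE w = 1
    · obtain ⟨z1, z2, z3⟩ := tvE w hE
      simp [hU, hE, evO, ev2, z1, z2, z3]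
    · obtain ⟨z1, z2, z3, z4, z5, z6⟩ := tv0 w hU hE
      simp [hU, hE, evO, ev2, z1, z2, z3, z4, z5, z6]
  · -- `d = 4h`
    subst hd
    have offRe := contrib2_off (c := h) (d := 4 * h) tARe tBRe w a4 b3 c2 d1
    have offIm := contrib2_off (c := h) (d := 4 * h) tAIm tBIm w a4 b3 c2 d1
    have offChi := contrib2_off (c := h) (d := 4 * h) tAchi tBchi w a4 b3 c2 d1
    rw [offRe.2, offIm.2, offChi.1, ← h2h', (contrib2_at hp h19 f2 tARe tBRe w).2.2.2.1,
      (contrib2_at hp h19 f2 tAIm tBIm w).2.2.2.1, (contrib2_at hp h19 f2 tAchi tBchi w).1.2.2.1]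
    by_cases hU : tU w = 1
    · exact absurd e (htop hU).1
    by_cases hE : tE w = 1
    · simp [hU, hE, evO, ev2]
    · obtain ⟨z1, z2, z3, z4, z5, z6⟩ := tv0 w hU hE
      simp [hU, hE, evO, ev2, z1, z2, z3, z4, z5, z6]
  · -- `d = -4h`
    subst hd
    have offRe := contrib2_off (c := h) (d := -(4 * h)) tARe tBRe w a5 b4 c3 d2
    have offIm := contrib2_off (c := h) (d := -(4 * h)) tAIm tBIm w a5 b4 c3 d2
    have offChi := contrib2_off (c := h) (d := -(4 * h)) tAchi tBchi w a5 b4 c3 d2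
    rw [offRe.2, offIm.2, offChi.1, ← h2h, (contrib2_at hp h19 f2 tARe tBRe w).2.2.2.2,
      (contrib2_at hp h19 f2 tAIm tBIm w).2.2.2.2, (contrib2_at hp h19 f2 tAchi tBchi w).1.2.2.2]
    by_cases hU : tU w = 1
    · exact absurd e (htop hU).2
    by_cases hE : tE w = 1
    · simp [hU, hE, evO, ev2]
    · obtain ⟨z1, z2, z3, z4, z5, z6⟩ := tv0 w hU hE
      simp [hU, hE, evO, ev2, z1, z2, z3, z4, z5, z6]
  · -- off all six fibres
    have ne3 : d ≠ 2 * (2 * h) := by rw [h2h']; exact n5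
    have ne4 : d ≠ -(2 * (2 * h)) := by rw [h2h]; exact n6
    rw [(contrib2_off tARe tBRe w n1 n2 n3 n4).2, (contrib2_off tAIm tBIm w n1 n2 n3 n4).2,
      (contrib2_off tAchi tBchi w n1 n2 n3 n4).1, (contrib2_off tARe tBRe w n3 n4 ne3 ne4).2,
      (contrib2_off tAIm tBIm w n3 n4 ne3 ne4).2, (contrib2_off tAchi tBchi w n3 n4 ne3 ne4).1]
    simp [evO, ev2]

/-! ### Case U: a unit-type member with no unit-type member over twice its fibre -/

/-- `ε i d ≠ ε′ j d` for signs `ε, ε′`, `d ≠ 0` and `p ∤ |i − j|, |i + j|`. [folklore] -/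
private theorem sign_mul_ne (hp : p.Prime) {d : ZMod p} (hd : d ≠ 0) {i j : ℤ} (h1 : ¬ p ∣ (i - j).natAbs)
    (h2 : ¬ p ∣ (i + j).natAbs) {e e' : ZMod p} (he : e = 1 ∨ e = -1) (he' : e' = 1 ∨ e' = -1) :
    e * ((i : ZMod p) * d) ≠ e' * ((j : ZMod p) * d) := by
  have h2' : ¬ p ∣ (i - -j).natAbs := by rwa [sub_neg_eq_add]
  have h3' : ¬ p ∣ (-i - j).natAbs := by rwa [show -i - j = -(i + j) by ring, Int.natAbs_neg]
  have h4' : ¬ p ∣ (-i - -j).natAbs := by rwa [show -i - -j = -(i - j) by ring, Int.natAbs_neg]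
  rcases he with rfl | rfl <;> rcases he' with rfl | rfl <;> intro e
  · exact kne hp hd h1 (by linear_combination e)
  · exact kne hp hd h2' (by push_cast; linear_combination e)
  · exact kne hp hd h3' (by push_cast; linear_combination e)
  · exact kne hp hd h4' (by push_cast; linear_combination e)

/-- **A top unit-type member exists**: some unit-type member off the fibre `0` has no unit-type member over `±2×` its fibre
(otherwise five members over `±d, ±2d, ±4d, ±8d, ±16d` would be distinct). [folklore] -/
private theorem top_exists (hp : p.Prime) (h19 : 19 ≤ p) {T : Multiset (ZMod 10 × ZMod p)} (hT : Multiset.card T = 4)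
    (hex : ∃ q ∈ T, tU q.1 = 1 ∧ q.2 ≠ 0) :
    ∃ q ∈ T, tU q.1 = 1 ∧ q.2 ≠ 0 ∧ ∀ q' ∈ T, tU q'.1 = 1 → q'.2 ≠ 2 * q.2 ∧ q'.2 ≠ -(2 * q.2) := by
  classical
  haveI := Fact.mk hp
  by_contra H
  push Not at H
  obtain ⟨q₀, hq₀, hu₀, hd₀⟩ := hex
  set d := q₀.2 with hdd
  have two0 : (2 : ZMod p) ≠ 0 := by exact_mod_cast kne0 hp one_ne_zero (k := 2) (nd_small h19 (by norm_num) (by norm_num))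
  -- the successor step
  have step : ∀ q ∈ T, tU q.1 = 1 → q.2 ≠ 0 → ∃ q' ∈ T, tU q'.1 = 1 ∧ q'.2 ≠ 0 ∧ ∃ e : ZMod p, (e = 1 ∨ e = -1) ∧ q'.2 = e * (2 * q.2) := by
    intro q hq hu hqd
    obtain ⟨q', hq', hu', h'⟩ := H q hq hu hqd
    have hq'2 : q'.2 = 2 * q.2 ∨ q'.2 = -(2 * q.2) := by
      by_cases e1 : q'.2 = 2 * q.2
      · exact Or.inl e1
      · exact Or.inr (h' e1)
    have hnz : q'.2 ≠ 0 := by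
      rcases hq'2 with e | e <;> rw [e]
      · exact mul_ne_zero two0 hqd
      · exact neg_ne_zero.2 (mul_ne_zero two0 hqd)
    rcases hq'2 with e | e
    · exact ⟨q', hq', hu', hnz, 1, Or.inl rfl, by rw [e, one_mul]⟩
    · exact ⟨q', hq', hu', hnz, -1, Or.inr rfl, by rw [e]; ring⟩
  obtain ⟨q₁, hq₁, hu₁, hd₁, e₁, he₁, hq₁2⟩ := step q₀ hq₀ hu₀ hd₀
  obtain ⟨q₂, hq₂, hu₂, hd₂, e₂, he₂, hq₂2⟩ := step q₁ hq₁ hu₁ hd₁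
  obtain ⟨q₃, hq₃, hu₃, hd₃, e₃, he₃, hq₃2⟩ := step q₂ hq₂ hu₂ hd₂
  obtain ⟨q₄, hq₄, hu₄, hd₄, e₄, he₄, hq₄2⟩ := step q₃ hq₃ hu₃ hd₃
  -- second coordinates as `ε 2ⁿ d`
  have sq : ∀ {e : ZMod p}, (e = 1 ∨ e = -1) → e * e = 1 := by rintro e (rfl | rfl) <;> ring
  have f₀ : q₀.2 = 1 * ((1 : ℤ) * d) := by push_cast; rw [hdd]; ring
  have f₁ : q₁.2 = e₁ * ((2 : ℤ) * d) := by rw [hq₁2]; push_cast; ring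
  have f₂ : q₂.2 = (e₂ * e₁) * ((4 : ℤ) * d) := by rw [hq₂2, hq₁2]; push_cast; ring
  have f₃ : q₃.2 = (e₃ * e₂ * e₁) * ((8 : ℤ) * d) := by rw [hq₃2, hq₂2, hq₁2]; push_cast; ring
  have f₄ : q₄.2 = (e₄ * e₃ * e₂ * e₁) * ((16 : ℤ) * d) := by rw [hq₄2, hq₃2, hq₂2, hq₁2]; push_cast; ring
  have sgn : ∀ {a b : ZMod p}, (a = 1 ∨ a = -1) → (b = 1 ∨ b = -1) → (a * b = 1 ∨ a * b = -1) := by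
    rintro a b (rfl | rfl) (rfl | rfl) <;> simp
  have s₁ : (1 : ZMod p) = 1 ∨ (1 : ZMod p) = -1 := Or.inl rfl
  have s₂ := sgn he₂ he₁
  have s₃ := sgn (sgn he₃ he₂) he₁
  have s₄ := sgn (sgn (sgn he₄ he₃) he₂) he₁
  have S : ∀ n : ℕ, 0 < n → n < 19 → ¬ p ∣ n := fun n h0 hn ↦ nd_small h19 h0 hn
  have S20 : ¬ p ∣ 20 := nd_mul hp (a := 4) (b := 5) (S 4 (by norm_num) (by norm_num)) (S 5 (by norm_num) (by norm_num))
  have S24 : ¬ p ∣ 24 := nd_mul hp (a := 4) (b := 6) (S 4 (by norm_num) (by norm_num)) (S 6 (by norm_num) (by norm_num))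
  have N : ∀ {a b : ZMod 10 × ZMod p}, a.2 ≠ b.2 → a ≠ b := fun hne e ↦ hne (by rw [e])
  have n01 : q₀ ≠ q₁ := N (by rw [f₀, f₁]; exact sign_mul_ne hp hd₀ (S _ (by norm_num) (by norm_num)) (S _ (by norm_num) (by norm_num)) s₁ he₁)
  have n02 : q₀ ≠ q₂ := N (by rw [f₀, f₂]; exact sign_mul_ne hp hd₀ (S _ (by norm_num) (by norm_num)) (S _ (by norm_num) (by norm_num)) s₁ s₂)
  have n03 : q₀ ≠ q₃ := N (by rw [f₀, f₃]; exact sign_mul_ne hp hd₀ (S _ (by norm_num) (by norm_num)) (S _ (by norm_num) (by norm_num)) s₁ s₃)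
  have n04 : q₀ ≠ q₄ := N (by rw [f₀, f₄]; exact sign_mul_ne hp hd₀ (S _ (by norm_num) (by norm_num)) (S _ (by norm_num) (by norm_num)) s₁ s₄)
  have n12 : q₁ ≠ q₂ := N (by rw [f₁, f₂]; exact sign_mul_ne hp hd₀ (S _ (by norm_num) (by norm_num)) (S _ (by norm_num) (by norm_num)) he₁ s₂)
  have n13 : q₁ ≠ q₃ := N (by rw [f₁, f₃]; exact sign_mul_ne hp hd₀ (S _ (by norm_num) (by norm_num)) (S _ (by norm_num) (by norm_num)) he₁ s₃)
  have n14 : q₁ ≠ q₄ := N (by rw [f₁, f₄]; exact sign_mul_ne hp hd₀ (S _ (by norm_num) (by norm_num)) (S _ (by norm_num) (by norm_num)) he₁ s₄)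
  have n23 : q₂ ≠ q₃ := N (by rw [f₂, f₃]; exact sign_mul_ne hp hd₀ (S _ (by norm_num) (by norm_num)) (S _ (by norm_num) (by norm_num)) s₂ s₃)
  have n24 : q₂ ≠ q₄ := N (by rw [f₂, f₄]; exact sign_mul_ne hp hd₀ (S _ (by norm_num) (by norm_num)) (by norm_num; exact S20) s₂ s₄)
  have n34 : q₃ ≠ q₄ := N (by rw [f₃, f₄]; exact sign_mul_ne hp hd₀ (S _ (by norm_num) (by norm_num)) (by norm_num; exact S24) s₃ s₄)
  -- five distinct members of a `4`-element multiset
  have hsub : ({q₀, q₁, q₂, q₃, q₄} : Finset (ZMod 10 × ZMod p)) ⊆ T.toFinset := by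
    intro q hq
    simp only [Finset.mem_insert, Finset.mem_singleton] at hq
    rw [Multiset.mem_toFinset]
    rcases hq with rfl | rfl | rfl | rfl | rfl <;> assumption
  have hcard : ({q₀, q₁, q₂, q₃, q₄} : Finset (ZMod 10 × ZMod p)).card = 5 := by
    rw [Finset.card_insert_of_notMem (by simp [n01, n02, n03, n04]), Finset.card_insert_of_notMem (by simp [n12, n13, n14]),
      Finset.card_insert_of_notMem (by simp [n23, n24]), Finset.card_pair n34]
  have := Finset.card_le_card hsub
  rw [hcard] at this
  have := Multiset.toFinset_card_le T
  omega

/-! ### Case U: the hypotheses of the enumeration from the relations -/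

/-- `cls h (2h) = 2`. [folklore] -/
private theorem cls_two (hp : p.Prime) (h19 : 19 ≤ p) {h : ZMod p} (hh : h ≠ 0) : cls h (2 * h) = 2 := by
  obtain ⟨⟨-, a2, -⟩, ⟨b1, -⟩, -⟩ := fib6 hp h19 hh
  rw [cls, if_neg a2, if_neg b1, if_pos rfl]

/-- `cls h 0 = 0`. [folklore] -/
private theorem cls_zero (hp : p.Prime) (h19 : 19 ≤ p) {h : ZMod p} (hh : h ≠ 0) : cls h 0 = 0 := by
  obtain ⟨-, -, -, -, -, f2, f4⟩ := fib6 hp h19 hh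
  have n1 : (0 : ZMod p) ≠ -h := fun e ↦ hh (neg_eq_zero.1 e.symm)
  have n2 : (0 : ZMod p) ≠ -(2 * h) := fun e ↦ f2 (neg_eq_zero.1 e.symm)
  have n4 : (0 : ZMod p) ≠ -(4 * h) := fun e ↦ f4 (neg_eq_zero.1 e.symm)
  rw [cls, if_neg (Ne.symm hh), if_neg n1, if_neg (Ne.symm f2), if_neg n2, if_neg (Ne.symm f4), if_neg n4]

/-- `|cls h d| ≤ 4`. [folklore] -/
private theorem cls_natAbs_le (h d : ZMod p) : (cls h d).natAbs ≤ 4 := by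
  unfold cls; split_ifs <;> decide

/-- `cls = ±4` pins the fibre `±4h`. [folklore] -/
private theorem eq_of_cls_four {h d : ZMod p} : (cls h d = 4 → d = 4 * h) ∧ (cls h d = -4 → d = -(4 * h)) := by
  rcases cls_cases h d with ⟨e, hd⟩ | ⟨e, hd⟩ | ⟨e, hd⟩ | ⟨e, hd⟩ | ⟨e, hd⟩ | ⟨e, hd⟩ | ⟨e, -⟩ <;> rw [e] <;>
    (constructor <;> intro hc <;> first | exact hd | norm_num at hc)

/-- The token of the distinguished member `q₁ = (u₁, 2h)`. [folklore] -/
private theorem tokOf_two (hp : p.Prime) (h19 : 19 ≤ p) {h : ZMod p} (hh : h ≠ 0) {u₁ : ZMod 10}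
    (hu : tU u₁ = 1 ∨ tE u₁ = 1) : tokOf h u₁ (2 * h) = some (u₁, 2) := by
  rw [tokOf, cls_two hp h19 hh]
  rcases hu with hu | hu
  · rw [if_pos (Or.inl ⟨hu, by norm_num⟩)]
  · rw [if_pos (Or.inr ⟨hu, by norm_num⟩)]

/-- The multiplier of a visible token is at most `4` in absolute value. [folklore] -/
private theorem tok_some_abs {h : ZMod p} {w w' : ZMod 10} {d : ZMod p} {l : ℤ} (ht : tokOf h w d = some (w', l)) :
    l.natAbs ≤ 4 := by
  unfold tokOf at ht
  split_ifs at ht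
  simp only [Option.some.injEq, Prod.mk.injEq] at ht
  rw [← ht.2]
  exact cls_natAbs_le h d

/-- In case E (unit types only in the fibre `0`) every token lies in `tokE`. [folklore] -/
private theorem tok_memE (hp : p.Prime) (h19 : 19 ≤ p) {h : ZMod p} (hh : h ≠ 0) (w : ZMod 10) (d : ZMod p)
    (hU : tU w = 1 → d = 0) : tokOf h w d ∈ tokE := by
  unfold tokOf
  split_ifs with hv
  · rcases hv with ⟨hw, hc⟩ | ⟨hw, hc⟩
    · exfalso
      rw [hU hw, cls_zero hp h19 hh] at hc
      norm_num at hc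
    · rcases tE_cases w hw with rfl | rfl | rfl | rfl <;> rcases hc with hc | hc | hc | hc <;> rw [hc] <;> decide
  · decide

/-- Members that are not opposite give tokens that are not opposite. [folklore] -/
private theorem tokPair_false {h : ZMod p} {qa qb : ZMod 10 × ZMod p} (hn : qa + qb ≠ 0) {ta tb : Option (ZMod 10 × ℤ)}
    (hta : ∀ w l, ta = some (w, l) → w = qa.1 ∧ qa.2 = (l : ZMod p) * h)
    (htb : ∀ w l, tb = some (w, l) → w = qb.1 ∧ qb.2 = (l : ZMod p) * h) : tokPair ta tb = false := by
  rcases ta with _ | ⟨w, l⟩ <;> rcases tb with _ | ⟨w', l'⟩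
  · rfl
  · rfl
  · rfl
  · simp only [tokPair, decide_eq_false_iff_not, not_and]
    intro e1 e2
    obtain ⟨rfl, ha⟩ := hta w l rfl
    obtain ⟨rfl, hb⟩ := htb w' l' rfl
    apply hn
    refine Prod.ext e1 ?_
    show qa.2 + qb.2 = 0
    rw [ha, hb, ← add_mul, ← Int.cast_add, e2, Int.cast_zero, zero_mul]

/-- **The hypotheses of the enumeration hold** for the tokens of the three other members, seen from a member
`q₁ = (u₁, 2h)` of unit or even type (unit types off `±4h`). [folklore] -/
private theorem hypTok_of_rels (hp : p.Prime) (h19 : 19 ≤ p) {h : ZMod p} (hh : h ≠ 0) {u₁ : ZMod 10}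
    (hu : tU u₁ = 1 ∨ tE u₁ = 1) {q₂ q₃ q₄ : ZMod 10 × ZMod p}
    (hR : Rels0 ({((u₁, 2 * h) : ZMod 10 × ZMod p), q₂, q₃, q₄} : Multiset (ZMod 10 × ZMod p)))
    (ht₂ : tU q₂.1 = 1 → cls h q₂.2 ≠ 4 ∧ cls h q₂.2 ≠ -4) (ht₃ : tU q₃.1 = 1 → cls h q₃.2 ≠ 4 ∧ cls h q₃.2 ≠ -4)
    (ht₄ : tU q₄.1 = 1 → cls h q₄.2 ≠ 4 ∧ cls h q₄.2 ≠ -4)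
    (n12 : ((u₁, 2 * h) : ZMod 10 × ZMod p) + q₂ ≠ 0) (n13 : ((u₁, 2 * h) : ZMod 10 × ZMod p) + q₃ ≠ 0)
    (n14 : ((u₁, 2 * h) : ZMod 10 × ZMod p) + q₄ ≠ 0) (n23 : q₂ + q₃ ≠ 0) (n24 : q₂ + q₄ ≠ 0) (n34 : q₃ + q₄ ≠ 0)
    (hs1 : u₁ + q₂.1 + q₃.1 + q₄.1 = 0) (hs2 : 2 * h + q₂.2 + q₃.2 + q₄.2 = 0) :
    hypTok u₁ (tokOf h q₂.1 q₂.2) (tokOf h q₃.1 q₃.2) (tokOf h q₄.1 q₄.2) = true := by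
  haveI := Fact.mk hp
  obtain ⟨-, -, -, -, -, f2, -⟩ := fib6 hp h19 hh
  have top₁ : tU u₁ = 1 → cls h (2 * h) ≠ 4 ∧ cls h (2 * h) ≠ -4 := fun _ ↦ by rw [cls_two hp h19 hh]; decide
  obtain ⟨r1₁, i1₁, c1₁, r2₁, i2₁, c2₁⟩ := tok_contrib hp h19 hh u₁ (2 * h) top₁
  rw [tokOf_two hp h19 hh hu] at r1₁ i1₁ c1₁ r2₁ i2₁ c2₁
  obtain ⟨r1₂, i1₂, c1₂, r2₂, i2₂, c2₂⟩ := tok_contrib hp h19 hh q₂.1 q₂.2 ht₂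
  obtain ⟨r1₃, i1₃, c1₃, r2₃, i2₃, c2₃⟩ := tok_contrib hp h19 hh q₃.1 q₃.2 ht₃
  obtain ⟨r1₄, i1₄, c1₄, r2₄, i2₄, c2₄⟩ := tok_contrib hp h19 hh q₄.1 q₄.2 ht₄
  obtain ⟨-, eC, eR, eI⟩ := cR_four ((u₁, 2 * h) : ZMod 10 × ZMod p) q₂ q₃ q₄ h
  obtain ⟨-, eC', eR', eI'⟩ := cR_four ((u₁, 2 * h) : ZMod 10 × ZMod p) q₂ q₃ q₄ (2 * h)
  dsimp only at eC eR eI eC' eR' eI'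
  generalize e₂ : tokOf h q₂.1 q₂.2 = t₂ at *
  generalize e₃ : tokOf h q₃.1 q₃.2 = t₃ at *
  generalize e₄ : tokOf h q₄.1 q₄.2 = t₄ at *
  have S1 : sum4 (evO tARe tBRe 1) (some (u₁, 2)) t₂ t₃ t₄ = 0 := by
    rw [sum4, ← r1₁, ← r1₂, ← r1₃, ← r1₄, ← eR]; exact hR.gre h hh
  have S2 : sum4 (evO tAIm tBIm 1) (some (u₁, 2)) t₂ t₃ t₄ = 0 := by
    rw [sum4, ← i1₁, ← i1₂, ← i1₃, ← i1₄, ← eI]; exact hR.gim h hh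
  have S3 : sum4 (ev2 tAchi tBchi 1) (some (u₁, 2)) t₂ t₃ t₄ = 0 := by
    rw [sum4, ← c1₁, ← c1₂, ← c1₃, ← c1₄, ← eC]; exact hR.relchi h hh
  have S4 : sum4 (evO tARe tBRe 2) (some (u₁, 2)) t₂ t₃ t₄ = 0 := by
    rw [sum4, ← r2₁, ← r2₂, ← r2₃, ← r2₄, ← eR']; exact hR.gre (2 * h) f2
  have S5 : sum4 (evO tAIm tBIm 2) (some (u₁, 2)) t₂ t₃ t₄ = 0 := by
    rw [sum4, ← i2₁, ← i2₂, ← i2₃, ← i2₄, ← eI']; exact hR.gim (2 * h) f2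
  have S6 : sum4 (ev2 tAchi tBchi 2) (some (u₁, 2)) t₂ t₃ t₄ = 0 := by
    rw [sum4, ← c2₁, ← c2₂, ← c2₃, ← c2₄, ← eC']; exact hR.relchi (2 * h) f2
  -- no pair
  have P1 : ∀ w l, some ((u₁, (2 : ℤ))) = some (w, l) →
      w = ((u₁, 2 * h) : ZMod 10 × ZMod p).1 ∧ ((u₁, 2 * h) : ZMod 10 × ZMod p).2 = (l : ZMod p) * h := by
    intro w l e
    simp only [Option.some.injEq, Prod.mk.injEq] at e
    obtain ⟨rfl, rfl⟩ := e
    exact ⟨rfl, by push_cast; rfl⟩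
  have P2 : ∀ w l, t₂ = some (w, l) → w = q₂.1 ∧ q₂.2 = (l : ZMod p) * h := fun w l e ↦ by
    obtain ⟨a, b, -⟩ := tok_some (e₂.trans e); exact ⟨a, b⟩
  have P3 : ∀ w l, t₃ = some (w, l) → w = q₃.1 ∧ q₃.2 = (l : ZMod p) * h := fun w l e ↦ by
    obtain ⟨a, b, -⟩ := tok_some (e₃.trans e); exact ⟨a, b⟩
  have P4 : ∀ w l, t₄ = some (w, l) → w = q₄.1 ∧ q₄.2 = (l : ZMod p) * h := fun w l e ↦ by
    obtain ⟨a, b, -⟩ := tok_some (e₄.trans e); exact ⟨a, b⟩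
  have Q12 := tokPair_false n12 P1 P2
  have Q13 := tokPair_false n13 P1 P3
  have Q14 := tokPair_false n14 P1 P4
  have Q23 := tokPair_false n23 P2 P3
  have Q24 := tokPair_false n24 P2 P4
  have Q34 := tokPair_false n34 P3 P4
  -- the sums
  have SUM : ∀ (w₂ w₃ w₄ : ZMod 10) (l₂ l₃ l₄ : ℤ), t₂ = some (w₂, l₂) → t₃ = some (w₃, l₃) → t₄ = some (w₄, l₄) →
      u₁ + w₂ + w₃ + w₄ = 0 ∧ 2 + l₂ + l₃ + l₄ = 0 := by
    intro w₂ w₃ w₄ l₂ l₃ l₄ f₂ f₃ f₄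
    obtain ⟨rfl, d₂, -⟩ := tok_some (e₂.trans f₂)
    obtain ⟨rfl, d₃, -⟩ := tok_some (e₃.trans f₃)
    obtain ⟨rfl, d₄, -⟩ := tok_some (e₄.trans f₄)
    have a₂ := tok_some_abs (e₂.trans f₂)
    have a₃ := tok_some_abs (e₃.trans f₃)
    have a₄ := tok_some_abs (e₄.trans f₄)
    refine ⟨hs1, ?_⟩
    by_contra hne
    have hz : ((2 + l₂ + l₃ + l₄ : ℤ) : ZMod p) * h = 0 := by
      rw [d₂, d₃, d₄] at hs2; push_cast; linear_combination hs2
    rcases mul_eq_zero.1 hz with hz | hz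
    · rw [ZMod.intCast_zmod_eq_zero_iff_dvd] at hz
      exact nd_small h19 (Int.natAbs_pos.2 hne) (by omega) (Int.natCast_dvd.1 hz)
    · exact hh hz
  have HR : hypRel u₁ t₂ t₃ t₄ = true := by
    simp only [hypRel, Bool.and_eq_true, decide_eq_true_eq]
    exact ⟨⟨⟨⟨⟨S1, S2⟩, S3⟩, S4⟩, S5⟩, S6⟩
  have HP : hypPair u₁ t₂ t₃ t₄ = true := by
    rw [hypPair, Q12, Q13, Q14, Q23, Q24, Q34]; rfl
  have HS : hypSum u₁ t₂ t₃ t₄ = true := by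
    clear HR HP
    rcases t₂ with _ | ⟨w₂, l₂⟩ <;> rcases t₃ with _ | ⟨w₃, l₃⟩ <;> rcases t₄ with _ | ⟨w₄, l₄⟩ <;>
      first | rfl | exact decide_eq_true (SUM _ _ _ _ _ _ rfl rfl rfl)
  rw [hypTok, HR, HP, HS]; rfl

/-- Reorderings of a `3`-element multiset. [folklore] -/
private theorem perm3 {X : Type*} (a b c : X) :
    ({a, c, b} : Multiset X) = {a, b, c} ∧ ({b, a, c} : Multiset X) = {a, b, c} ∧ ({b, c, a} : Multiset X) = {a, b, c} ∧
      ({c, a, b} : Multiset X) = {a, b, c} ∧ ({c, b, a} : Multiset X) = {a, b, c} := by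
  simp only [Multiset.insert_eq_cons, ← Multiset.cons_zero]
  refine ⟨by rw [Multiset.cons_swap c b], by rw [Multiset.cons_swap b a], ?_, ?_, ?_⟩
  · rw [Multiset.cons_swap c a, Multiset.cons_swap b a]
  · rw [Multiset.cons_swap c a, Multiset.cons_swap c b]
  · rw [Multiset.cons_swap b a, Multiset.cons_swap c a, Multiset.cons_swap c b]

/-- Two reorderings of a `4`-element multiset. [folklore] -/
private theorem perm4 {X : Type*} (a b c d : X) :
    ({a, b, c, d} : Multiset X) = {b, d, a, c} ∧ ({a, b, c, d} : Multiset X) = {b, c, a, d} := by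
  simp only [Multiset.insert_eq_cons, ← Multiset.cons_zero]
  refine ⟨?_, ?_⟩
  · rw [Multiset.cons_swap a b, Multiset.cons_swap c d, Multiset.cons_swap a d]
  · rw [Multiset.cons_swap a b, Multiset.cons_swap a c]

/-- **Case U in coordinates**: the three other members seen from a top unit-type member `(u₁, 2h)`. [folklore] -/
private theorem caseU_coords (hp : p.Prime) (h19 : 19 ≤ p) {h : ZMod p} (hh : h ≠ 0) {u₁ : ZMod 10} (hu : tU u₁ = 1)
    {q₂ q₃ q₄ : ZMod 10 × ZMod p}
    (hR : Rels0 ({((u₁, 2 * h) : ZMod 10 × ZMod p), q₂, q₃, q₄} : Multiset (ZMod 10 × ZMod p)))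
    (ht₂ : tU q₂.1 = 1 → cls h q₂.2 ≠ 4 ∧ cls h q₂.2 ≠ -4) (ht₃ : tU q₃.1 = 1 → cls h q₃.2 ≠ 4 ∧ cls h q₃.2 ≠ -4)
    (ht₄ : tU q₄.1 = 1 → cls h q₄.2 ≠ 4 ∧ cls h q₄.2 ≠ -4)
    (n12 : ((u₁, 2 * h) : ZMod 10 × ZMod p) + q₂ ≠ 0) (n13 : ((u₁, 2 * h) : ZMod 10 × ZMod p) + q₃ ≠ 0)
    (n14 : ((u₁, 2 * h) : ZMod 10 × ZMod p) + q₄ ≠ 0) (n23 : q₂ + q₃ ≠ 0) (n24 : q₂ + q₄ ≠ 0) (n34 : q₃ + q₄ ≠ 0)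
    (hs1 : u₁ + q₂.1 + q₃.1 + q₄.1 = 0) (hs2 : 2 * h + q₂.2 + q₃.2 + q₄.2 = 0) :
    ∃ qa qb qc : ZMod 10 × ZMod p, ({q₂, q₃, q₄} : Multiset (ZMod 10 × ZMod p)) = {qa, qb, qc} ∧
      qb = (-(2 * u₁), -(4 * h)) ∧ ((qa = (u₁ + 5, 2 * h) ∧ qc = (5, 0)) ∨
        ∃ v : ZMod 10, tU v = 1 ∧ 2 * v = u₁ + 5 ∧ qa = (v, h) ∧ qc = (v + 5, h)) := by
  have H := hypTok_of_rels hp h19 hh (Or.inl hu) hR ht₂ ht₃ ht₄ n12 n13 n14 n23 n24 n34 hs1 hs2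
  have C := enumU hu (tok_mem _ _ ht₂) (tok_mem _ _ ht₃) (tok_mem _ _ ht₄) H
  have h55 : (5 : ZMod 10) + 5 = 0 := by decide
  have fin : ∀ {qa qb qc : ZMod 10 × ZMod p}, ({q₂, q₃, q₄} : Multiset (ZMod 10 × ZMod p)) = {qa, qb, qc} →
      (patA u₁ (tokOf h qa.1 qa.2) (tokOf h qb.1 qb.2) (tokOf h qc.1 qc.2) ∨
        patB u₁ (tokOf h qa.1 qa.2) (tokOf h qb.1 qb.2) (tokOf h qc.1 qc.2)) →
      ∃ qa qb qc : ZMod 10 × ZMod p, ({q₂, q₃, q₄} : Multiset (ZMod 10 × ZMod p)) = {qa, qb, qc} ∧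
        qb = (-(2 * u₁), -(4 * h)) ∧ ((qa = (u₁ + 5, 2 * h) ∧ qc = (5, 0)) ∨
          ∃ v : ZMod 10, tU v = 1 ∧ 2 * v = u₁ + 5 ∧ qa = (v, h) ∧ qc = (v + 5, h)) := by
    intro qa qb qc hperm hpat
    have hs1' : u₁ + qa.1 + qb.1 + qc.1 = 0 := by
      have e := congrArg (fun t : Multiset (ZMod 10 × ZMod p) ↦ (t.map Prod.fst).sum) hperm
      simp only [Multiset.insert_eq_cons, Multiset.map_cons, Multiset.map_singleton, Multiset.sum_cons,
        Multiset.sum_singleton] at e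
      linear_combination hs1 - e
    have hs2' : 2 * h + qa.2 + qb.2 + qc.2 = 0 := by
      have e := congrArg (fun t : Multiset (ZMod 10 × ZMod p) ↦ (t.map Prod.snd).sum) hperm
      simp only [Multiset.insert_eq_cons, Multiset.map_cons, Multiset.map_singleton, Multiset.sum_cons,
        Multiset.sum_singleton] at e
      linear_combination hs2 - e
    refine ⟨qa, qb, qc, hperm, ?_⟩
    rcases hpat with ⟨ea, eb, ec⟩ | ⟨⟨v, hv, h2v, ea⟩, eb, ec⟩
    · obtain ⟨wa, da, -⟩ := tok_some ea
      obtain ⟨wb, db, -⟩ := tok_some eb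
      push_cast at da db
      rw [← wa, ← wb] at hs1'
      rw [da, db] at hs2'
      refine ⟨Prod.ext wb.symm (by rw [db]; ring), Or.inl ⟨Prod.ext wa.symm da, Prod.ext ?_ ?_⟩⟩
      · show qc.1 = 5
        linear_combination hs1' - h55
      · show qc.2 = 0
        linear_combination hs2'
    · obtain ⟨wa, da, -⟩ := tok_some ea
      obtain ⟨wb, db, -⟩ := tok_some eb
      push_cast at da db
      rw [← wa, ← wb] at hs1'
      rw [da, db] at hs2'
      refine ⟨Prod.ext wb.symm (by rw [db]; ring), Or.inr ⟨v, hv, h2v, Prod.ext wa.symm (by rw [da]; ring),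
        Prod.ext ?_ ?_⟩⟩
      · show qc.1 = v + 5
        linear_combination hs1' - h2v - h55
      · show qc.2 = h
        linear_combination hs2'
  obtain ⟨P1, P2, P3, P4, P5⟩ := perm3 q₂ q₃ q₄
  rcases C with hc | hc | hc | hc | hc | hc
  · exact fin rfl hc
  · exact fin P1.symm hc
  · exact fin P2.symm hc
  · exact fin P3.symm hc
  · exact fin P4.symm hc
  · exact fin P5.symm hc

/-! ### From coordinates back to `ℤ/10p` -/

/-- `5p ↦ (5, 0)`. [folklore] -/
private theorem K10_eq (h : Nat.Coprime 10 p) [NeZero (10 * p)] (hp : p.Prime) (h19 : 19 ≤ p) :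
    K10 = crtPt10 h 5 0 := by
  obtain ⟨k, hk⟩ := hp.odd_of_ne_two (by omega)
  rw [← pt_crt h K10, crt_natCast]
  have h10 : (10 : ZMod 10) = 0 := by decide
  congr 1
  · rw [hk, show 5 * (2 * k + 1) = 10 * k + 5 by ring]
    push_cast
    rw [h10]; ring
  · push_cast
    rw [ZMod.natCast_self, mul_zero]

/-- `s` from its coordinates. [folklore] -/
private theorem eq_map_symm (h : Nat.Coprime 10 p) (s : Multiset (ZMod (10 * p))) :
    s = (s.map (crt h)).map (crt h).symm := by
  rw [Multiset.map_map]
  conv_lhs => rw [← Multiset.map_id s]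
  exact Multiset.map_congr rfl fun x _ ↦ ((crt h).symm_apply_apply x).symm

/-- The `α`-pattern in coordinates is an `α`-multiset. [folklore] -/
private theorem isStd_of_coords_alpha (h : Nat.Coprime 10 p) [NeZero (10 * p)] (hp : p.Prime) (h19 : 19 ≤ p)
    {s : Multiset (ZMod (10 * p))} {u : ZMod 10} {y : ZMod p}
    (hT : s.map (crt h) = {(u, 2 * y), (u + 5, 2 * y), (-(2 * u), -(4 * y)), (5, 0)}) : IsStd s := by
  have hK := K10_eq h hp h19
  have m2 := natCast_mul_pt h 2 u (2 * y)
  push_cast at m2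
  refine ⟨crtPt10 h u (2 * y), Or.inl ?_⟩
  rw [eq_map_symm h s, hT]
  simp only [Multiset.insert_eq_cons, Multiset.map_cons, Multiset.map_singleton, ← crtPt_eq]
  have e2 : crtPt10 h (u + 5) (2 * y) = crtPt10 h u (2 * y) + K10 := by rw [hK, pt_add, add_zero]
  have e3 : crtPt10 h (-(2 * u)) (-(4 * y)) = -(2 * crtPt10 h u (2 * y)) := by
    rw [m2, neg_pt, show -(2 * (2 * y)) = -(4 * y) by ring]
  rw [e2, e3, ← hK]

/-- The `β`-pattern in coordinates is a `β`-multiset. [folklore] -/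
private theorem isStd_of_coords_beta (h : Nat.Coprime 10 p) [NeZero (10 * p)] (hp : p.Prime) (h19 : 19 ≤ p)
    {s : Multiset (ZMod (10 * p))} {u₁ v : ZMod 10} {y : ZMod p} (hv2 : 2 * v = u₁ + 5)
    (hT : s.map (crt h) = {(v, y), (v + 5, y), (u₁, 2 * y), (-(2 * u₁), -(4 * y))}) : IsStd s := by
  have hK := K10_eq h hp h19
  have m2 := natCast_mul_pt h 2 v y
  have m4 := natCast_mul_pt h 4 v y
  push_cast at m2 m4
  have h10 : (10 : ZMod 10) = 0 := by decide
  refine ⟨crtPt10 h v y, Or.inr ?_⟩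
  rw [eq_map_symm h s, hT]
  simp only [Multiset.insert_eq_cons, Multiset.map_cons, Multiset.map_singleton, ← crtPt_eq]
  have e2 : crtPt10 h (v + 5) y = crtPt10 h v y + K10 := by rw [hK, pt_add, add_zero]
  have e3 : crtPt10 h u₁ (2 * y) = 2 * crtPt10 h v y + K10 := by
    rw [hK, m2, pt_add, add_zero]
    congr 1
    linear_combination -hv2 - h10
  have e4 : crtPt10 h (-(2 * u₁)) (-(4 * y)) = -(4 * crtPt10 h v y) := by
    rw [m4, neg_pt]
    congr 1
    linear_combination 2 * hv2 + h10
  rw [e2, e3, e4]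

/-- Pair-freeness passes to the coordinates. [folklore] -/
private theorem pairfree_crt (h : Nat.Coprime 10 p) {s : Multiset (ZMod (10 * p))}
    (hpf : ∀ a ∈ s, ∀ b ∈ s.erase a, a + b ≠ 0) :
    ∀ a ∈ s.map (crt h), ∀ b ∈ (s.map (crt h)).erase a, a + b ≠ 0 := by
  classical
  intro a ha b hb
  obtain ⟨x, hx, rfl⟩ := Multiset.mem_map.1 ha
  rw [← Multiset.map_erase _ (crt h).injective, Multiset.mem_map] at hb
  obtain ⟨x', hx', rfl⟩ := hb
  rw [← _root_.map_add]
  exact (map_ne_zero_iff (crt h) (crt h).injective).2 (hpf x hx x' hx')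

/-- Presenting a `4`-multiset from one member. [folklore] -/
private theorem exists_eq_four₁ {X : Type*} {T : Multiset X} (hT : Multiset.card T = 4) {a : X} (ha : a ∈ T) :
    ∃ b c d : X, T = {a, b, c, d} := by
  obtain ⟨T', rfl⟩ := Multiset.exists_cons_of_mem ha
  simp only [Multiset.card_cons] at hT
  obtain ⟨b, c, d, rfl⟩ := Multiset.card_eq_three.mp (by omega : Multiset.card T' = 3)
  exact ⟨b, c, d, rfl⟩

/-- Presenting a `4`-multiset from two distinct members. [folklore] -/
private theorem exists_eq_four₂ {X : Type*} [DecidableEq X] {T : Multiset X} (hT : Multiset.card T = 4) {a b : X}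
    (ha : a ∈ T) (hb : b ∈ T) (hab : a ≠ b) : ∃ c d : X, T = {a, b, c, d} := by
  obtain ⟨T', rfl⟩ := Multiset.exists_cons_of_mem ha
  have hb' : b ∈ T' := (Multiset.mem_cons.1 hb).resolve_left (Ne.symm hab)
  obtain ⟨T'', rfl⟩ := Multiset.exists_cons_of_mem hb'
  simp only [Multiset.card_cons] at hT
  obtain ⟨c, d, rfl⟩ := Multiset.card_eq_two.mp (by omega : Multiset.card T'' = 2)
  exact ⟨c, d, rfl⟩

/-- Pair conditions and coordinate sums of a presented quadruple. [folklore] -/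
private theorem four_facts {T : Multiset (ZMod 10 × ZMod p)} (hpf : ∀ a ∈ T, ∀ b ∈ T.erase a, a + b ≠ 0)
    (hsum : T.sum = 0) {a b c d : ZMod 10 × ZMod p} (hT : T = {a, b, c, d}) :
    (a + b ≠ 0 ∧ a + c ≠ 0 ∧ a + d ≠ 0 ∧ b + c ≠ 0 ∧ b + d ≠ 0 ∧ c + d ≠ 0) ∧
      a.1 + b.1 + c.1 + d.1 = 0 ∧ a.2 + b.2 + c.2 + d.2 = 0 := by
  classical
  refine ⟨six_pairs hT hpf, ?_, ?_⟩
  · have e := congrArg Prod.fst hsum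
    rw [hT] at e
    simp only [Multiset.insert_eq_cons, Multiset.sum_cons, Multiset.sum_singleton, Prod.fst_add, Prod.fst_zero] at e
    linear_combination e
  · have e := congrArg Prod.snd hsum
    rw [hT] at e
    simp only [Multiset.insert_eq_cons, Multiset.sum_cons, Multiset.sum_singleton, Prod.snd_add, Prod.snd_zero] at e
    linear_combination e

/-- **Case U.** A unit-type member off the fibre `0` forces `α` or `β`. [folklore] -/
private theorem caseU (h : Nat.Coprime 10 p) [NeZero (10 * p)] (hp : p.Prime) (h19 : 19 ≤ p)
    {s : Multiset (ZMod (10 * p))} (hcard : Multiset.card s = 4) (hpf : ∀ a ∈ s, ∀ b ∈ s.erase a, a + b ≠ 0)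
    (hsum : s.sum = 0) (hR : Rels0 (s.map (crt h))) (hex : ∃ q ∈ s.map (crt h), tU q.1 = 1 ∧ q.2 ≠ 0) : IsStd s := by
  classical
  have hTc : Multiset.card (s.map (crt h)) = 4 := by rw [Multiset.card_map, hcard]
  have hpfT := pairfree_crt h hpf
  have hsumT : (s.map (crt h)).sum = 0 := by rw [← map_multiset_sum, hsum, _root_.map_zero]
  generalize hT : s.map (crt h) = T at hTc hpfT hsumT hR hex
  obtain ⟨⟨u₁, d₁⟩, hq₁, hu₁, hd₁, htop⟩ := top_exists hp h19 hTc hex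
  dsimp only at hu₁ hd₁ htop
  obtain ⟨y, hy⟩ := exists_half hp h19 d₁
  subst hy
  have hy0 : y ≠ 0 := by rintro rfl; exact hd₁ (mul_zero _)
  obtain ⟨q₂, q₃, q₄, hTq⟩ := exists_eq_four₁ hTc hq₁
  obtain ⟨⟨n12, n13, n14, n23, n24, n34⟩, hs1, hs2⟩ := four_facts hpfT hsumT hTq
  dsimp only at hs1 hs2
  have ht : ∀ q ∈ ({q₂, q₃, q₄} : Multiset (ZMod 10 × ZMod p)), tU q.1 = 1 → cls y q.2 ≠ 4 ∧ cls y q.2 ≠ -4 := by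
    intro q hq hu
    have hq' : q ∈ T := by rw [hTq]; exact Multiset.mem_cons_of_mem hq
    obtain ⟨a, b⟩ := htop q hq' hu
    exact ⟨fun e ↦ a (by rw [eq_of_cls_four.1 e]; ring), fun e ↦ b (by rw [eq_of_cls_four.2 e]; ring)⟩
  rw [hTq] at hR
  obtain ⟨qa, qb, qc, hperm, rfl, hcase⟩ := caseU_coords hp h19 hy0 hu₁ hR (ht q₂ (by simp)) (ht q₃ (by simp))
    (ht q₄ (by simp)) n12 n13 n14 n23 n24 n34 hs1 hs2
  rw [hperm] at hTq
  rcases hcase with ⟨rfl, rfl⟩ | ⟨v, -, h2v, rfl, rfl⟩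
  · exact isStd_of_coords_alpha h hp h19 (hT.trans hTq)
  · rw [(perm4 _ _ _ _).1] at hTq
    exact isStd_of_coords_beta h hp h19 h2v (hT.trans hTq)

/-- **Case E.** No unit-type member off the fibre `0` but an even-type one: impossible. [folklore] -/
private theorem caseE (h : Nat.Coprime 10 p) [NeZero (10 * p)] (hp : p.Prime) (h19 : 19 ≤ p)
    {s : Multiset (ZMod (10 * p))} (hcard : Multiset.card s = 4) (hpf : ∀ a ∈ s, ∀ b ∈ s.erase a, a + b ≠ 0)
    (hsum : s.sum = 0) (hR : Rels0 (s.map (crt h))) (hU : ¬ ∃ q ∈ s.map (crt h), tU q.1 = 1 ∧ q.2 ≠ 0)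
    (hex : ∃ q ∈ s.map (crt h), tE q.1 = 1 ∧ q.2 ≠ 0) : False := by
  classical
  have hTc : Multiset.card (s.map (crt h)) = 4 := by rw [Multiset.card_map, hcard]
  have hpfT := pairfree_crt h hpf
  have hsumT : (s.map (crt h)).sum = 0 := by rw [← map_multiset_sum, hsum, _root_.map_zero]
  generalize hT : s.map (crt h) = T at hTc hpfT hsumT hR hex hU
  obtain ⟨⟨e₁, d₁⟩, hq₁, he₁, hd₁⟩ := hex
  dsimp only at he₁ hd₁
  obtain ⟨y, hy⟩ := exists_half hp h19 d₁
  subst hy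
  have hy0 : y ≠ 0 := by rintro rfl; exact hd₁ (mul_zero _)
  obtain ⟨q₂, q₃, q₄, hTq⟩ := exists_eq_four₁ hTc hq₁
  obtain ⟨⟨n12, n13, n14, n23, n24, n34⟩, hs1, hs2⟩ := four_facts hpfT hsumT hTq
  dsimp only at hs1 hs2
  have hz : ∀ q ∈ ({q₂, q₃, q₄} : Multiset (ZMod 10 × ZMod p)), tU q.1 = 1 → q.2 = 0 := by
    intro q hq hu
    have hq' : q ∈ T := by rw [hTq]; exact Multiset.mem_cons_of_mem hq
    by_contra hne
    exact hU ⟨q, hq', hu, hne⟩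
  have ht : ∀ q ∈ ({q₂, q₃, q₄} : Multiset (ZMod 10 × ZMod p)), tU q.1 = 1 → cls y q.2 ≠ 4 ∧ cls y q.2 ≠ -4 := by
    intro q hq hu
    rw [hz q hq hu, cls_zero hp h19 hy0]
    decide
  rw [hTq] at hR
  have H := hypTok_of_rels hp h19 hy0 (Or.inr he₁) hR (ht q₂ (by simp)) (ht q₃ (by simp)) (ht q₄ (by simp)) n12 n13 n14
    n23 n24 n34 hs1 hs2
  exact enumE he₁ (tok_memE hp h19 hy0 _ _ (hz q₂ (by simp))) (tok_memE hp h19 hy0 _ _ (hz q₃ (by simp)))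
    (tok_memE hp h19 hy0 _ _ (hz q₄ (by simp))) H

/-! ### The remaining types `{0, 5}` off the fibre `0` -/

/-- A residue mod `10` that is neither a unit nor of even type is `0` or `5`. [folklore] -/
private theorem type05 : ∀ w : ZMod 10, tU w ≠ 1 → tE w ≠ 1 → w = 0 ∨ w = 5 := by decide

/-- Sums of residues in `{0, 5}`. [folklore] -/
private theorem sum05 : ∀ z a b c : ZMod 10, (a = 0 ∨ a = 5) → (b = 0 ∨ b = 5) → (c = 0 ∨ c = 5) →
    z + a + b + c = 0 → z = 0 ∨ z = 5 := by decide

/-- **The pair-free Hodge `4`-multisets of level `10p`, `p ≥ 19` prime** (Shioda's `(Q′)` at `m = 10p`; Aoki–Shioda's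
Theorem (𝔅²ₘ) (ii) with no exceptional element): a Hodge multiset `s` over `ℤ/10p` with four members and no pair `{a, −a}` is
`α_x = {x, x + 5p, −2x, 5p}` or `β_x = {x, x + 5p, 2x + 5p, −4x}` (`3 ∤ 10p`: no `γ`; the level `10` has no exceptional
quadruple, Shioda's table `Δ(10) = −2`). Proof: this file (CRT coordinates, the Koblitz–Ogus relations of
`KoblitzOgusRelationsTenPrime`, `Γ ≡ 0` by a free parameter, a kernel enumeration of the relative positions `{±½, ±1, ±2}` seen
from a top unit-type member, and the levels `10` (kernel) and `2p` (`exists_perm_std_twicePrime`) for the degenerate fibres).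
[cite: Shioda1982PicardFermat, §4 Lemma 1 (a) p. 728, Prop. 4 (Q′) p. 729, table p. 727 (m = 10)]
[cite: AokiShioda1983, §2 Theorem (𝔅²ₘ) (ii) a), b), p. 3] [cite: MeyerNeutsch1981Fermatquadrupel, Satz 2 p. 56, Tabelle 1 p. 54] -/
theorem classify_hodgeMultiset_tenPrime [NeZero (10 * p)] (hp : p.Prime) (h19 : 19 ≤ p) {s : Multiset (ZMod (10 * p))}
    (hs : IsHodgeMultiset s) (hcard : Multiset.card s = 4) (hind : ∀ a ∈ s, ∀ b ∈ s.erase a, a + b ≠ 0) :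
    ∃ x : ZMod (10 * p), s = {x, x + K10, -(2 * x), K10} ∨ s = {x, x + K10, 2 * x + K10, -(4 * x)} := by
  classical
  have h := coprime_ten hp (by omega)
  have hTc : Multiset.card (s.map (crt h)) = 4 := by rw [Multiset.card_map, hcard]
  have hR := rels0_of_rels hp h19 hTc (rels_of_isHodgeMultiset h hp (by omega) hs)
  have hsum : s.sum = 0 := hs.1.2
  by_cases hU : ∃ q ∈ s.map (crt h), tU q.1 = 1 ∧ q.2 ≠ 0
  · exact caseU h hp h19 hcard hind hsum hR hU
  by_cases hE : ∃ q ∈ s.map (crt h), tE q.1 = 1 ∧ q.2 ≠ 0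
  · exact (caseE h hp h19 hcard hind hsum hR hU hE).elim
  by_cases hZ : ∀ q ∈ s.map (crt h), q.2 = 0
  · exact fibre_zero h hp hs hcard hind fun w hw ↦ hZ _ (Multiset.mem_map_of_mem _ hw)
  by_cases h5 : ∀ q ∈ s.map (crt h), q.1 = 0 ∨ q.1 = 5
  · refine case_five hp h19 hs hcard hind fun w hw ↦ ?_
    have key := fst_val_mod_five h w
    refine Nat.dvd_of_mod_eq_zero ?_
    rw [← key]
    rcases h5 _ (Multiset.mem_map_of_mem _ hw) with e | e <;> rw [e] <;> decide
  -- a member `qZ` in the fibre `0` of type `∉ {0, 5}` and a member `qO` off the fibre `0`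
  have hO : ∀ q ∈ s.map (crt h), q.2 ≠ 0 → q.1 = 0 ∨ q.1 = 5 := fun q hq hd ↦
    type05 q.1 (fun hu ↦ hU ⟨q, hq, hu, hd⟩) (fun he ↦ hE ⟨q, hq, he, hd⟩)
  have hpfT := pairfree_crt h hind
  have hsumT : (s.map (crt h)).sum = 0 := by rw [← map_multiset_sum, hsum, _root_.map_zero]
  generalize s.map (crt h) = T at hTc hR hZ h5 hO hpfT hsumT
  push Not at hZ h5
  obtain ⟨qO, hqO, hdO⟩ := hZ
  obtain ⟨qZ, hqZ, hZ0, hZ5⟩ := h5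
  have hdZ : qZ.2 = 0 := by
    by_contra hne
    rcases hO qZ hqZ hne with e | e
    · exact hZ0 e
    · exact hZ5 e
  have hne : qZ ≠ qO := fun e ↦ hdO (by rw [← e]; exact hdZ)
  obtain ⟨q₃, q₄, hT4⟩ := exists_eq_four₂ hTc hqZ hqO hne
  obtain ⟨⟨-, -, -, nO3, nO4, -⟩, hs1, hs2⟩ := four_facts hpfT hsumT hT4
  have m3 : q₃ ∈ T := by rw [hT4]; simp
  have m4 : q₄ ∈ T := by rw [hT4]; simp
  have tO := hO _ hqO hdO
  obtain ⟨wZ, dZ⟩ := qZ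
  obtain ⟨wO, y⟩ := qO
  obtain ⟨w₃, d₃⟩ := q₃
  obtain ⟨w₄, d₄⟩ := q₄
  dsimp only at hdO hZ0 hZ5 hdZ hs1 hs2 tO nO3 nO4
  subst hdZ
  by_cases h3 : d₃ = 0 <;> by_cases h4 : d₄ = 0
  · subst h3 h4
    exact (hdO (by linear_combination hs2)).elim
  · subst h3
    have e4 : d₄ = -y := by linear_combination hs2
    subst e4
    have h12 : wO + w₄ ≠ 0 := fun e ↦ nO4 (Prod.ext e (by simp))
    rw [hT4, (perm4 _ _ _ _).1] at hR
    exact two_off hp h19 hdO h12 hR |>.elim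
  · subst h4
    have e3 : d₃ = -y := by linear_combination hs2
    subst e3
    have h12 : wO + w₃ ≠ 0 := fun e ↦ nO3 (Prod.ext e (by simp))
    rw [hT4, (perm4 _ _ _ _).2] at hR
    exact two_off hp h19 hdO h12 hR |>.elim
  · have t3 := hO _ m3 h3
    have t4 := hO _ m4 h4
    dsimp only at t3 t4
    rcases sum05 wZ wO w₃ w₄ tO t3 t4 hs1 with e | e
    · exact (hZ0 e).elim
    · exact (hZ5 e).elim

end TenPrime

end Literature.AlgebraicGeometry.Shioda1982
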